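import Mathlib
import HarnessLib
import HarnessLib.Audit
import Summits.QuantumFields.Statement
import Literature.Barriers.QuantumFields.FiniteTemperatureDeconfinement
import Literature.MathematicalPhysics.QuantumFieldTheory.QCDSlab
import Literature.MathematicalPhysics.QuantumLattice.TwistedBoundaryConditions

/-!
Route: FemtoStepScaling

DORMANT since 2026-09-05T00:13:27Z (reconciler: no traction for 5 d (last activity statement-checked at 2026-08-30T23:34:00Z); parked, not closed — `ledger route dormant route-QuantumFields-FemtoStepScaling --off` to reactivate) — unstaffed, not closed; items shared with open routes are served there. `ledger route dormant <id> --off` reactivates.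

# Route FemtoStepScaling — femto-universe first, then a one-variable ladder — finite-volume
continuum limits, box-mixing step scaling and a physical-units finite-size closure for the QCD gap

It suffices to show X = X_UV ∧ X_IR ∧ X_χ ∧ X_cl ∧ X_pkg, the typed spine of card
femto-universe-step-scaling (F1–F5) plus the chiral edge forced by the statement re-type of
2026-08-16 (`QCDOf` gained `reg.IsChiralAtZero`), all stated for
honest lattice QCD (Wilson gauge action, N_f ∈ {2,3} Berezin-integrated Wilson quarks, signed
determinant, `qcdTorusExpect`) on
PERIODIC HYPERCUBIC tori along ONE two-loop asymptotically scaling, mass-independent regularisation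
`reg` (β_k − afBeta N_f Λ a_k → 0,
Z_m with leading-log growth, m_crit(k) > −1, CHIRAL AT ZERO: m_crit pinned at or below the chiral
critical line), with the femto-universe gap theorem (F1 (ii)–(iii): a cutoff- and T-uniform gap ≥
κ₀(1 − O(g²(ℓ)))/ℓ, κ₀ = 2π/3, of the
't Hooft-twisted N_f = 0 SU(3) femto box read in the zero-electric-flux frame along the magnetic
flux) TYPED as the rank-2 crux
FemtoUniverseGapR (rev 2 repair of the informal FemtoUniverseGap, refuted-misstated), and its N_f =
0 periodic pilot typed as support
(FemtoGluePilot). X_UV = FiniteVolumeContinuumLimitC ("the step-scaling function exists, on a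
chirally pinned regularisation"): there is such a
`reg`, chiral at zero (`reg.IsChiralAtZero`, the Statement's own clause — only the item that chooses
m_crit can pin it), for which, for every positive mass tuple, the renormalised smeared n-point
functions of glue and pseudoscalar bilinears converge
on EVERY fixed physical 4-torus of side ℓ ≥ ℓ₀, non-degenerately (glue two-point and κ₃ ≠ 0, every
flavour-changing pseudoscalar
propagates). X_IR = BoxMixingDecayR ("σ has no fixed point; the ladder climbs past every
threshold"): for such a `reg` and masses
above an offset M₀, the BOX MIXING at scale ℓ — the sup-normalised connected time-covariance across
half the ℓ-hypercube of bounded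
gauge-invariant gluonic observables supported in time-slabs of thickness ℓ/8 (the transfer-matrix
proxy 2e^(−3z/8) of the
Lüscher–Weisz–Wolff variable z = m(ℓ)ℓ) — can be made ≤ ε for every ε > 0 by enlarging ℓ,
cutoff-uniformly. X_χ = SharpChiralEdge ("the ladder reaches the chiral corner, and the corner is
gapless"; rev 3): for such a `reg`, chiral at zero, box-mixing decay above SOME offset extends to
EVERY tuple above an edge Mχ ≥ 0 at which the uniform lattice gap closes from above (∀ ε > 0 some
tuple m > Mχ has ¬HasLatticeMassGap ε — Goldstone). X_cl =
PhysicalFiniteSizeCriterionR (the closure): universal ε, c > 0 such that box mixing ≤ ε at ONE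
physical scale ℓ, eventually in the
cutoff, forces connected time-correlations of all gluonic observables to decay at rate c/ℓ on all
larger periodic tori, uniformly in
spacing and volume. X_pkg = InfiniteVolumePackageC: UV limits + gluonic uniform gap above an offset
M₀ ≥ 0 AT WHICH THE LATTICE GAP CLOSES ⇒ QCDOf N_f (OS data, non-triviality,
dynamical quarks, T.HasMassGap, the full HasLatticeMassGap, and IsChiralAtZero of the M₀-shifted
regularisation = the transported edge). Assembly X → QCD is pure logic (`closes`, re-proved for rev
3 in the planner's Sketch.lean).
Lean: `FiniteVolumeContinuumLimitC ∧ BoxMixingDecayR ∧ SharpChiralEdge ∧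
PhysicalFiniteSizeCriterionR ∧ InfiniteVolumePackageC` (decls of this route file; each is the
inlined one-line Prop of its block below — 'let-via-∀' abbreviations `∀ Ex, Ex = qcdTorusExpect …
→`, `∀ ι, ι = algebraMap … →`, `∀ InSlab, InSlab = … →` keep them readable (each ≤ 4000 chars) —
over `Literature.MathematicalPhysics.QuantumFieldTheory.{QCDRegularisation, afBeta, qcdTorusExpect,
insertion, FermiAlg, YMSpecies, QCDField, fermiIntegral, fermiBoltzmann, wilsonMeasure}`,
`Literature.MathematicalPhysics.QuantumLattice.{torusLift, configShift, siteToE, fundamentalRep}`,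
`Literature.Probability.LatticeModels.box`, `QCDRegularisation.IsChiralAtZero`,
`QCDScheme.HasLatticeMassGap`, `_root_.QCDOf`; Sketch.lean rc 0)

## Assembly
Pure logic, machine-checked (`closes`, rev 3 re-proved in the planner's Sketch.lean with `theorem
assembly_holds : Assembly := closes`, farm rc 0, axioms propext/choice/Quot.sound): fix N_f ∈ {2,3};
FiniteVolumeContinuumLimitC
gives `reg` with the good-trajectory clauses, `reg.IsChiralAtZero` and the UV clause;
BoxMixingDecayR turns (good, weak UV clause) into an offset M₀ with box-mixing decay above it;
SharpChiralEdge turns (good, IsChiralAtZero, ∃ M₀ decay) into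
an edge Mχ ≥ 0 with decay above Mχ and the gapless-edge clause; for m > Mχ (so m > 0 is at hand, Mχ
≥ 0 replacing rev 1's max M₀ 0) and the universal ε of PhysicalFiniteSizeCriterionR there is a scale
ℓ(m) with box mixing ≤ ε eventually; the criterion (fed asymptotic scaling, m_crit > −1 eventually,
m > 0) returns the gluonic uniform gap
with Δ = c/ℓ(m) > 0; InfiniteVolumePackageC converts (reg, UV clause, ⟨Mχ, 0 ≤ Mχ, ∀ m > Mχ ∃ Δ > 0
gap, edge at Mχ⟩) into QCDOf N_f; N_f = 2 and 3 give QCD.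

REV 1 (2026-08-15, planner route-repair after refuter route-review rreview-0815T13-5; objection +
evidence EVIDENCE_FSS_FVCL.md on stmt-QuantumFields-8887). The four typed cruxes were superseded 1:1
by repaired decls with suffix R (rev-0 FiniteVolumeContinuumLimit stmt-8887, BoxMixingDecay
stmt-8886, PhysicalFiniteSizeCriterion stmt-8885, InfiniteVolumePackage stmt-8888 are dropped, not
reworded in place; the Assembly item is restated over the R decls, stmt-8890 → stmt-11452). WHAT
CHANGED, and nothing else: (a) the finite-volume convergence clause (in FiniteVolumeContinuumLimitR
and in its inlined copies, the hypotheses of BoxMixingDecayR and InfiniteVolumePackageR) is GUARDED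
by pairwise-disjoint closed supports of the real test functions, `(∀ i j, i ≠ j → Disjoint (tsupport
(f i)) (tsupport (f j))) → Tendsto …` — Schwinger functions of renormalised composite fields are
distributions on ⁰𝒮 only (the Statement's IsQCDAlong asks convergence on IsOffDiagonal tensors);
unguarded, UV power counting (z_glue ≍ 1/(g²a⁴), |x−y|⁻⁸ singularity of ⟨trF² trF²⟩) made (CONV) ∧
(N1) ∧ (N3) unsatisfiable, so X_UV was false, X_IR's hypothesis idle and X_pkg vacuous as typed; (b)
the non-degeneracy witnesses are TIME-SEPARATED for N1/N2 (`tsupport f ⊆ {x | x 0 < 0}`, `tsupport g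
⊆ {x | 0 < x 0}`, the mirror of OSData.IsNontrivial's Θf* ⊗ g) and PAIRWISE DISJOINT for N3 (mirror
of OSData.IsNonGaussian's IsOffDiagonal), so white noise, contact terms and decoupled quarks (m_crit
→ +∞ with a blown-up z_P) no longer pass them and 'dynamical quarks' is certified; (c)
PhysicalFiniteSizeCriterionR carries the two side conditions the refuter recommended (non-blocking
remark on stmt-8885), `(∀ᶠ k, −1 < reg.mcrit k)` and `(∀ fl, 0 < m fl)`: the closure is no longer
asserted for bare Wilson masses ≤ −1 (κ ≥ 1/6, outside Lüscher/Osterwalder–Seiler transfer-matrix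
positivity, Montvay–Münster (4.111)) or through the Aoki region, where time-slab mixing ⇒ gap has no
mechanism; `closes` feeds them from the good-trajectory clause and from the offset max M₀ 0. The
box-mixing clause, the gap shapes, FemtoGluePilot (checked) and the informal rank-2 crux
FemtoUniverseGap were untouched by rev 1; `closes` re-proved (Sketch.lean rc 0, axioms propext /
Classical.choice / Quot.sound).

REV 2 (2026-08-15, planner route-repair after crux-attacks gen-0/gen-2 on the informal crux
FemtoUniverseGap stmt-QuantumFields-9483, class refuted-misstated; evidence EVIDENCE.md,
FiniteChecks.lean, EVIDENCE-g2.md, FemtoCruxCertificatesG2.lean on that item). FemtoUniverseGap is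
superseded 1:1 (`route edit --restate`, new decl FemtoUniverseGapR, now TYPED over
FiniteTemperature.expectation / slabLift / YMSpecies / centerPhase / afBeta; imports QCDSlab,
TwistedBoundaryConditions added). WHAT CHANGED, and nothing else: (a) FLUX FRAME — witness (A): with
spatial twist n₁₂ = 1 the three twist-eating vacua (ω^j·1, P, Q) are permuted by the exact Z₃ centre
symmetry along the magnetic flux m = (0,0,1), so the electric-flux sectors e₃ ∈ Z₃ are degenerate to
all orders and split only by tunnelling ∝ exp(−8π²/(3g²(ℓ))) (van Baal hep-ph/0008206 §3.4 'states
that differ only by the e₃ quantum number are degenerate'; RTN hep-lat/9302007 p. 3; Poppitz–Wandler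
arXiv:2211.10347 §5.1: E(θ,e₃) − E_pert = −c̃Le^(−S₀)cos(θ/N − 2πe₃/N)); the time-periodic slab
ensemble is their equal-weight mixture, so 'ALL bounded gauge-invariant observables, c uniform in T,
c = κ₀(1 − O(g²))' was false (Polyakov loop along m). The repaired item PROJECTS the ensemble to e₃
= 0 by averaging the twisted Boltzmann weights over the temporal twist n₀₃ ∈ Z₃ and restricts the
observables to those NEUTRAL for the flux along m (invariant under multiplying the x₃ ≡ −1 (mod S)
links in direction 3 by a centre element); transverse-flux sectors (e ⊥ m: one gluon) remain in the
thermal trace as genuine excitations of energy ≥ κ₀/ℓ, κ₀ = 2π/3 = |Poynting vector| of one unit of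
transverse flux (DGKA 1990; van Baal §3.4), which is why κ₀ and the class 'all gauge-invariant
observables incl. Polyakov loops along directions 1, 2' survive (the e = 0 / fully centre-invariant
variant with κ₀′ = 4π/3 is the expected corollary, not filed); (b) the C-periodic variant is DROPPED
(witness (B): SU(3) C-periodic b.c. keep the real abelian so(3) toron valley, g^(2/3) regime, 4-fold
perturbative vacuum degeneracy — Kronfeld–Wiese hep-lat/9210008), and with it N_f = 2, which has no
toron-free femto box of either kind; (c) N_f = 3 (colour–flavour twist forces m_u = m_d = m_s and a
recomputed κ, witnesses (C)/(D)) and part (i) of rev 0 (finite-volume continuum limit of slab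
expectations — UV existence of the FiniteVolumeContinuumLimitR kind, untouched by the refutation)
are NOT asserted by the typed item; (d) C and S₀ are quantified before S, T, n and the observables,
which are sup-normalised. `closes` is untouched (FemtoUniverseGapR, like FemtoUniverseGap before it,
is not a hypothesis of the deciding theorem: it is the route's base-rung bet — the first
cutoff-uniform gap theorem the line claims is provable now); planner's Sketch.lean rc 0 (farm, 0
errors).

REV 3 (2026-08-16, planner route-repair, statement-revised p117723: `def QCDOf` gained the conjunct
`reg.IsChiralAtZero` — for every ε > 0 some POSITIVE mass tuple has no uniform lattice gap ε — which
pins the flavour-blind additive offset of m_crit to the chiral point; the threshold reading `∀ m > 0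
≡ ∀ m > M₀` (qcdOf_iff_threshold) that rev 0–2 leaned on through the device `∃ M₀, ∀ m > M₀` + `max
M₀ 0` + "shift m_crit by the offset" is gone: the M₀-shifted regularisation is chiral at zero iff
the lattice gap of `reg` closes at M₀⁺, retype probe shifted_not_chiral). `closes` still elaborated
textually after the re-type (InfiniteVolumePackageR concludes `QCDOf Nf` by name) but that item had
silently absorbed an undischargeable burden (locate the chiral point of an arbitrary `reg` and reach
every mass above it from hypotheses that only speak of masses > 0 and > M₀). WHAT CHANGED, and
nothing else: (a) FiniteVolumeContinuumLimitR → FiniteVolumeContinuumLimitC (`--restate`, new decl):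
the produced `reg` is additionally `reg.IsChiralAtZero` — the Statement's clause verbatim,
discharged by the producer because only the item that CHOOSES m_crit(k) can pin it at or below the
critical line (a pin above the line would leave renormalised masses (0, M₀] unreachable by every
item; a pin strictly below is allowed); (b) NEW crux SharpChiralEdge (rank 7): for good `reg` chiral
at zero, box-mixing decay above some offset (BoxMixingDecayR's conclusion) extends to every tuple
above an edge Mχ ≥ 0 at which the uniform lattice gap closes from above — the chiral regime
(arbitrarily light massive pions) and the Goldstone gaplessness the re-type imports, as ONE
separately refutable statement; (c) InfiniteVolumePackageR → InfiniteVolumePackageC (`--restate`,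
new decl): the offset hypothesis becomes `∃ M₀, 0 ≤ M₀ ∧ (gap above M₀) ∧ (edge at M₀)`, so the
intended M₀-shifted witness is chiral at zero by transport (Sketch.lean `example`:
`QCDScheme.mk.injEq` + `ring`) and the item's burden is exactly rev 1's; (d) Assembly restated over
the rev-3 chain and `closes` re-proved with hypotheses FiniteVolumeContinuumLimitC, BoxMixingDecayR,
SharpChiralEdge, PhysicalFiniteSizeCriterionR, InfiniteVolumePackageC (Sketch.lean farm rc 0, 0
warnings). BoxMixingDecayR, PhysicalFiniteSizeCriterionR, FemtoUniverseGapR, FemtoGluePilot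
untouched.

Rationale: WHY THIS LINE. Mechanism (card femto-universe-step-scaling): do the UV problem where it is a UV
problem — on a compact 4-torus, where a continuum limit is Bałaban/Magnen–Rivasseau–Sénéor territory
(Balaban1987RG1, Balaban1989LargeFieldII, MagnenRivasseauSeneor1993) and, in the femto regime ℓΛ ≪ 1
with flat directions killed by an 't Hooft twist (tHooft1979Flux, Luscher1983,
doi:10.1016/0003-4916(87)90032-7), even the gap c/ℓ is perturbatively visible — and carry the whole
infrared problem by ONE real variable per scale, the ALPHA step-scaling philosophy "finite volume IS
the scheme" (doi:10.1016/0550-3213(91)90298-c, doi:10.1016/0550-3213(94)90629-7, arXiv:2101.04762)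
turned into a proof architecture: base (femto), inductive step (no fixed point), termination (a
finite-size closure in PHYSICAL units). Imported areas: constructive RG (UV), transfer-matrix
spectral theory (the box-mixing proxy is ρ-mixing in Euclidean time, Luscher1977,
OsterwalderSeiler1978 — time-slab mixing has NO Dobrushin–Shlosman entropy factor (ℓ/a)³), and
finite-size criteria of statistical mechanics (DobrushinShlosman1985, doi:10.1007/bf02101929)
transplanted to physical units. What the line does that nothing else on the ledger does: it types
the infrared half of the Millennium content as crisp, separately refutable statements about one
scale (BoxMixingDecayR, SharpChiralEdge, PhysicalFiniteSizeCriterionR) over the tree's own signed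
lattice-QCD functional; since the re-type of 2026-08-16 (rev 3) the mass offset is no longer a free
device but the CHIRAL EDGE: the producer pins m_crit at or below the critical line
(`reg.IsChiralAtZero`), SharpChiralEdge locates the gapless edge Mχ ≥ 0 and extends box-mixing decay
down to it, the package shifts by exactly Mχ — and the universally quantified cruxes stay
true-or-false independently of witness pathologies (pins strictly below the line, θ = π-like
trajectories below it) because every hypothesis they need about the pin is explicit.

RANKED CRUXES. #2 FemtoUniverseGapR (crux; rev 2 — TYPED 1:1 replacement of the informal
FemtoUniverseGap stmt-9483, refuted-misstated: flux frame added; C-periodic / N_f = 2, 3 variants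
and part (i) dropped) — THE FEMTO-UNIVERSE GAP (card F1 (ii)–(iii); rank 2: the bet that a
cutoff-uniform gap theorem is provable NOW where every mode is weakly coupled; base rung of the
ladder). SU(3), N_f = 0, anisotropic lattice ℤ_T × (ℤ/S)³, J = afBeta 0 Λ (ℓ/S); spatial twist n₁₂ =
1; ensemble PROJECTED to e₃ = 0 (average over the temporal twist n₀₃ ∈ Z₃); admissible observables =
gluonic YMSpecies via `slabLift`, sup ≤ 1, in the time slab 0 ≤ x₀ ≤ S/8, flux-neutral along m.
CLAIM: ∀ Λ > 0 ∃ ε₀ > 0, K ∀ ℓ ∈ (0, ε₀/Λ] ∃ C, S₀ ∀ S ≥ S₀ ∀ T ≥ S ∀ n ≤ T/2 ∀ admissible A, B: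
|⟨A(0)B(n)⟩ − ⟨A(0)⟩⟨B(n)⟩| ≤ C exp(−(2π/3)(1 − K/log(1/(ℓΛ))) n/S) — a cutoff- and T-uniform
transfer-matrix gap ≥ κ₀(1 − O(g²(ℓ)))/ℓ in the e₃ = 0 frame, κ₀ = 2π/3 (one unit of transverse
electric flux; DGKA 1990, van Baal §3.4). [difficulty: XL] (why it might fail: weak-coupling RG
controls effective ACTIONS, not spectra (UVStabilityNonUniqueness); a T-uniform gap needs
Bałaban-type expansions run around three twist-eating backgrounds with the Z₃ flux projection and
the thermal e⊥m sectors bounded — nothing such is in print.) [Luscher1983, arXiv:hep-ph/0008206,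
doi:10.1016/0370-2693(90)90797-a, arXiv:hep-lat/9302007, arXiv:2211.10347, Balaban1989LargeFieldII]
#3 PhysicalFiniteSizeCriterionR (crux; rev 1 — side conditions m_crit(k) > −1 eventually and m_f > 0
added; untouched by rev 3) — THE CLOSURE (card F4). Universal ε, c > 0 such that for N_f ∈ {2,3},
every `reg` with asymptotic scaling and m_crit(k) > −1 eventually, every POSITIVE tuple m and scale
ℓ > 0: if eventually in k, on the torus of side 2⌊ℓ/2a_k⌋+1 at (β_k, m_f(k)), the (−1)^F-twisted
partition function is non-zero and every pair of bounded gluonic cylinder observables in the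
time-slab [0, ℓ/8] has connected covariance ≤ ε across half the box, THEN all gluonic connected
time-correlations on ALL periodic tori of side 2S+1 ≥ 2L_k+1 decay like C e^(−(c/ℓ) a_k n), n ≤ S,
eventually in k (Δ = c/ℓ). [difficulty: open-problem] (why it might fail: known finite-size criteria
(Dobrushin–Shlosman, Martinelli–Olivieri) are lattice-scale with entropy factors (ℓ/a)³ that diverge
as a→0; time-slab mixing = gap of H on the ℓ³ torus, and m(ℓ) ≫ 1/ℓ need not control m(∞) without an
RG step inside the closure.) [DobrushinShlosman1985, doi:10.1007/bf02101929,
doi:10.1007/978-94-011-1691-6_38, Luscher1977, JaffeWitten2000, doi:10.1016/0550-3213(86)90252-x]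
#4 BoxMixingDecayR (crux; rev 1 — hypothesis = the GUARDED convergence clause + time-separated N2;
untouched by rev 3) — THE LADDER'S OUTPUT (card F2 ∧ F3: "σ exists and has no fixed point, so
finitely many doublings pass any threshold"). For N_f ∈ {2,3} and every good `reg` (mass scaling,
asymptotic scaling, m_crit(k) > −1 eventually), IF the finite-volume continuum limits exist with
dynamical quarks (disjoint-support convergence + time-separated N2 only), THEN there is an offset M₀
such that for all tuples m > M₀ and every ε > 0 there is a physical scale ℓ at which, eventually in
k, the twisted partition function is non-zero and the box mixing (sup-normalised slab covariance
across half the ℓ-hypercube, all bounded gluonic observables) is ≤ ε; since rev 3 the offset is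
handed to SharpChiralEdge, which drives it down to the chiral edge. [deps:
FiniteVolumeContinuumLimitC] [difficulty: open-problem] (why it might fail: this IS 'no infrared
fixed point and the box eventually exceeds the correlation length' for N_f = 2, 3 — the gap
conjecture in finite-size form; σ(u) > u is provable only for small u (asymptotic freedom), no
monotone quantity in ℓ is known beyond PT.) [doi:10.1016/0550-3213(91)90298-c,
doi:10.1016/0550-3213(94)90629-7, arXiv:2101.04762, arXiv:1604.06193, JaffeWitten2000,
Luscher2010WilsonFlow]
#5 FiniteVolumeContinuumLimitC (crux; rev 3 of FiniteVolumeContinuumLimitR stmt-11450 — the produced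
`reg` is additionally `reg.IsChiralAtZero`, nothing else; rev 1: guarded convergence, time-separated
N1/N2, pairwise-disjoint N3) — 'THE STEP-SCALING FUNCTION EXISTS, ON A CHIRALLY PINNED
REGULARISATION' (card F1(i) ∪ F2: UV control on a compact torus of ANY fixed physical size). For N_f
∈ {2,3} there is a regularisation `reg` (a_k → 0, β_k − afBeta N_f Λ a_k → 0, volumes, flavour-blind
m_crit(k) > −1 eventually, Z_m(k) ≍ c (log a_k⁻²)^(γ₀/2β₀)), CHIRAL AT ZERO (for every ε > 0 some
positive tuple has no uniform lattice gap ε: m_crit sits at or below the chiral critical line to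
o(a_k/Z_m(k)) — only the item that chooses m_crit can pin it; a pin above the line would leave
renormalised masses (0, M₀] out of every item's reach), such that for EVERY positive mass tuple m
there are species renormalisations z_s(k), shift_s(k), a limit functional W and ℓ₀ > 0 with: for
every ℓ ≥ ℓ₀, every species string σ and real test functions f_i WITH PAIRWISE-DISJOINT CLOSED
SUPPORTS, the smeared renormalised n-point function (smearedInsertion formula, box pinned to
physical side ℓ) under qcdTorusExpect on the torus of side 2⌊ℓ/2a_k⌋+1 converges to W ℓ n σ f;
non-degenerately: a time-separated connected glue two-point value ≠ 0 (N1), every flavour-changing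
pseudoRe f g time-separated connected two-point value ≠ 0 (N2 — white noise, contact terms and
decoupled quarks fail it), a pairwise-disjoint connected glue three-point value κ₃ ≠ 0 (N3).
Content: a-uniform bounds + equicontinuity + non-degeneracy of renormalised composite-field
correlators at every fixed physical volume, plus the pin (its IR content — cutoff-uniform light
pions near the critical line — is separable as a lemma `--supports` this item). [difficulty:
open-problem] (why it might fail: needs a-uniform control of RENORMALISED composite-field
expectations (tr F² with a⁻⁴ scaling, ψ̄γ₅ψ) at every fixed physical volume incl. box-scale strong
coupling — beyond Bałaban's stability (UVStabilityNonUniqueness); and m_crit pinned at/below κ_c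
with cutoff-uniform light pions there (Goldstone on the lattice, unproved).) [Balaban1987RG1,
Balaban1989LargeFieldII, MagnenRivasseauSeneor1993, MontvayMunster1994, arXiv:hep-lat/9207009,
arXiv:2401.10507, doi:10.1103/physrevd.58.074501]
#6 InfiniteVolumePackageC (crux; rev 3 of InfiniteVolumePackageR stmt-11451 — the offset hypothesis
now carries `0 ≤ M₀` and the gapless edge at M₀, nothing else) — THE PACKAGE (card F5). For N_f ∈
{2,3} and every `reg` with mass scaling, asymptotic scaling, m_crit > −1 eventually and the
non-degenerate finite-volume limits of FiniteVolumeContinuumLimitC (UV clause only): if above some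
mass offset M₀ ≥ 0 every mass tuple has SOME Δ > 0 with the gluonic uniform lattice gap (connected
time-correlations of all gluonic cylinder observables ≤ C e^(−Δ a_k n) on all tori 2S+1 ≥ 2L_k+1, n
≤ S, eventually in k) AND the uniform lattice gap closes at M₀⁺ (∀ ε > 0 ∃ m > M₀,
¬HasLatticeMassGap ε), then QCDOf N_f: shift m_crit by the offset (HasMassScaling kept;
IsChiralAtZero of the shifted regularisation IS the transported edge, Sketch.lean), pass to infinite
volume along the scheme's own tori (volume independence from clustering), build the OS data (E0–E4
as fields, E0' growth, rotation invariance; convergence upgraded to all IsOffDiagonal tensors on the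
growing tori), read IsNontrivial / IsNonGaussian / dynamical quarks off N1–N3, T.HasMassGap Δ from
the lattice gap, and extend the lattice gap from gluonic to ALL gauge-invariant observables (mesons,
baryons). [deps: FiniteVolumeContinuumLimitC, PhysicalFiniteSizeCriterionR, SharpChiralEdge]
[difficulty: XL] (why it might fail: Gluonic time-slab clustering must yield volume independence,
E0' (n! growth), full SO(4) invariance of the limit and decay of QUARK observables (exceptional
configurations of D_W near κ_c under a signed determinant) — none is in print for 4D lattice QCD.)
[OsterwalderSeiler1978, Seiler1982, Luscher1977, OsterwalderSchrader1975, JaffeWitten2000,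
MontvayMunster1994]
#7 SharpChiralEdge (crux; NEW at rev 3 — the content the re-type p117723 makes load-bearing; ranked
7 = least 'provable now', the chiral regime) — THE SHARP CHIRAL EDGE. For N_f ∈ {2,3} and every
`reg` with mass scaling, asymptotic scaling, m_crit > −1 eventually which is CHIRAL AT ZERO: if box
mixing decays above SOME offset M₀ (BoxMixingDecayR's conclusion: ∀ m > M₀ ∀ ε > 0 ∃ ℓ > 0,
eventually in k the twisted partition function ≠ 0 and the sup-normalised slab covariance across
half the ℓ-hypercube ≤ ε), then there is an edge Mχ ≥ 0 with (a) box-mixing decay for EVERY tuple m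
> Mχ (arbitrarily light massive pions; no non-chiral obstruction between the heavy regime and the
edge) and (b) the edge gapless from above: ∀ ε > 0 ∃ m > Mχ, ¬(reg.scheme m 0 0).HasLatticeMassGap ε
(Goldstone: m_π → 0 as m → Mχ⁺, cutoff-uniformly; both Sharpe–Singleton scenarios give m_π^min → 0
in physical units). Mχ = the chiral point of `reg` in its own coordinates, ≥ 0 exactly because `reg`
is chiral at zero; without that hypothesis the statement would be false for regularisations pinned
above the line. [deps: FiniteVolumeContinuumLimitC, BoxMixingDecayR] [difficulty: open-problem] (why
it might fail: the chiral regime of N_f = 2, 3 lattice QCD — slab mixing → 0 for arbitrarily light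
pions in the (−1)^F ensemble, and a Goldstone UPPER bound m_π → 0 at the edge uniform in a: χSB / 't
Hooft–Vafa–Witten gaplessness is physics, not theorem; Aoki or first-order structure at κ_c.)
[MontvayMunster1994, doi:10.1103/physrevd.58.074501, doi:10.1103/physrevd.46.5607,
doi:10.1016/0370-2693(87)91296-2, doi:10.1007/978-1-4684-7571-5_9, doi:10.1016/0550-3213(84)90230-x,
doi:10.1007/bf01211589, JaffeWitten2000]
#9 FemtoGluePilot (support) — N_f = 0 PERIODIC PILOT of the femto-universe theorem in the
anisotropic vocabulary of Literature.Barriers.QuantumFields.FiniteTemperature (Lüscher's 1983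
setting): ∀ Λ > 0 ∃ ε₀ > 0 such that for every physical box ℓ ≤ ε₀/Λ there are c > 0, C, S₀ with:
for all S ≥ S₀ (a = ℓ/S, J_E = J_M = afBeta 0 Λ (ℓ/S)), all T ≥ S, n ≤ T/2, the connected
correlation of spatial plaquettes at times 0 and n is ≤ C e^(−c n/S) — a cutoff- and T-uniform gap ≥
c/ℓ of the full transfer matrix on the periodic ℓ³ box (c NON-perturbative: flux-sector tunnelling,
van Baal–Koller). [difficulty: XL] [Luscher1983, doi:10.1016/0550-3213(84)90038-5,
doi:10.1016/0550-3213(87)90031-9, doi:10.1016/0550-3213(86)90252-x,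
doi:10.1016/0003-4916(87)90032-7, BorgsSeiler1983, Balaban1989LargeFieldII]

TWO-LAYER PLAN. Foreseen glued splits (nothing filed; k ≤ 3, depth 1). BoxMixingDecayR ⇐ FemtoStart
("in the femto regime the box-mixing/step variable is finite, computable and RUNS per asymptotic
freedom, σ(u) = u + 2b₀ln2·u² + O(u³), as an inequality between two continuum finite-volume
theories" — the periodic-box shadow of FemtoUniverseGapR) → SigmaNoFixedPoint ("the step map z(ℓ) ↦
z(2ℓ) exceeds the identity by δ(K) > 0 on compacts"; D3) → BoxMixingDecayR.
FiniteVolumeContinuumLimitC ⇐ FemtoContinuumLimit (ℓΛ ≤ ε₀, every mode weakly coupled) →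
StepExtension (UV control at 2ℓ from ℓ: finitely many new coarse modes) → ChiralPin (m_crit(k) := a
femto-box PCAC or pion-mass definition of the critical line; cutoff-uniform light pions above it) →
FiniteVolumeContinuumLimitC. SharpChiralEdge ⇐ LightQuarkLadder (decay for every tuple above the
edge: no fixed point of the step map at any positive pion mass) → GoldstoneEdge (∀ ε ∃ m > Mχ with a
lattice pseudoscalar correlator decaying slower than ε, cutoff-uniformly: a GMOR-type upper bound) →
SharpChiralEdge. PhysicalFiniteSizeCriterionR ⇐ SlabToBlock (time-slab mixing at scale ℓ ⇒ a
Dobrushin–Shlosman-type condition for BLOCK variables of side ℓ/4, cutoff-uniformly) →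
BlockCriterion (one RG step inside the closure, shared with YangMills card
finite-size-criterion-crossover) → PhysicalFiniteSizeCriterionR. InfiniteVolumePackageC ⇐
GluonicToHadronic → OSReconstructionWithGap (the Mχ-shift is three lines, Sketch.lean).

KILL CRITERIA. BoxMixingDecayR refuted (an infrared fixed point / gapless N_f = 2 or 3 QCD at
positive masses, or box mixing ≥ ε₀ at all scales along every good trajectory) closes the route
`refuted:BoxMixingDecayR` — essentially ¬QCD; PhysicalFiniteSizeCriterionR refuted by a lattice QCD
trajectory mixing at one scale yet not uniformly gapped forces a PIVOT to the block-variable closure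
(split above) with a stronger hypothesis (mixing on a window of scales [ℓ, 2ℓ]);
FiniteVolumeContinuumLimitC refuted in its non-degeneracy clauses (e.g. κ₃ = 0 forced) → restate N3
with a four-point cumulant, refuted in its pin (no chirally pinned regularisation has finite-volume
limits — cutoff-uniform light pions incompatible with Wilson fermions at asymptotic scaling) is
essentially ¬QCD as re-typed and closes the route; SharpChiralEdge refuted by a non-chiral
obstruction to decay at intermediate masses (a first-order wall in m with light but massive modes)
forces a PIVOT to an edge-local statement (decay on (Mχ, Mχ + δ) ∪ (M₀, ∞) plus an interpolation
crux), refuted in (b) for a chiral-at-zero `reg` means the decay/gap dictionary fails → restate (b)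
over slab mixing instead of HasLatticeMassGap; FemtoGluePilot refuted (exact flux-sector degeneracy
or no cutoff-uniform gap in the periodic femto box) kills only the periodic form of F1 and makes the
twist mandatory; FemtoUniverseGapR refuted SUBSTANTIVELY (a further exact degeneracy inside the e₃ =
0 frame for flux-neutral observables, or a lightest e₃ = 0 excitation below κ₀(1 − O(g²))/ℓ at weak
coupling) kills the femto base rung — the route survives formally (`closes` does not use it) but
loses its 'provable now' anchor; refuted-MISSTATED again ⇒ restate in the e = 0 / fully
centre-invariant frame (κ₀′ = 4π/3). (History: rev-0 FiniteVolumeContinuumLimit mis-typed →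
repaired; FemtoUniverseGap stmt-9483 refuted-misstated → FemtoUniverseGapR; no negative edge on live
items.) YangMills-sub or another QCD route proving HasLatticeMassGap along an AF trajectory moots
BoxMixingDecayR ∧ PhysicalFiniteSizeCriterionR (they follow).

NOT DECOMPOSED YET. The e = 0 (fully centre-invariant) variant of the femto gap with κ₀′ = 4π/3, the
N_f = 3 mass-degenerate colour–flavour-twisted variant and part (i) (finite-volume continuum limit
in the twisted box) — corollaries / later support items of FemtoUniverseGapR, not filed; the step
map σ as a named object (D3) and the split of BoxMixingDecayR into base + step; the constants (κ₀,
b₀, the universal ε, c of the closure); the fermionic extension and OS reconstruction inside the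
package; the GMOR exponent / rate at which the gap closes at the edge (only gaplessness is claimed)
and the light-quark splits of SharpChiralEdge; uniqueness (vs subsequential existence) of
finite-volume limits; N_f = 0 (a YangMills route with the same X) and N_f > 3.

CHEAPEST FALSIFIER. (i) A transfer-matrix lemma check (paper-and-pencil / Lean sketch): on the
(−1)^F-twisted hypercube, is the sup-normalised slab covariance really ≤ 2e^(−3m(ℓ)ℓ/8)(1 +
O(e^(−(M_B−m)ℓ))) with M_B the lightest fermion-odd state? If light baryon-number-odd torus states
spoil it at moderate ℓ, ℓ(m, ε) must grow — not fatal, it fixes the proxy. (ii) Literature kill for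
BoxMixingDecayR / SharpChiralEdge (a): accepted evidence of infrared conformality at N_f = 3
fundamental (none: the conformal window starts at N_f ≈ 8–12; ALPHA's non-perturbative σ for N_f = 3
runs monotonically from ḡ² ≈ 1 to the hadronic regime, arXiv:1604.06193, arXiv:1607.06423). (iii)
For PhysicalFiniteSizeCriterionR, the card's O(3)-model test (kit): in the 2D O(3) σ-model measure
the slab covariance across L×L boxes at fixed z = m(L)L for a/L = 1/8 … 1/64 — a universal ε ⇒ c
relation independent of a/L supports the crux; an ε shrinking like a power of a/L kills the
time-slab form and forces the block version. (iv) Typing check of the edge clause: `EDGE(0) ↔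
IsChiralAtZero` is `Iff.rfl` and the M₀-shift transports EDGE(M₀) to IsChiralAtZero of the shifted
regularisation (Sketch.lean, farm rc 0) — the clause is exactly the Statement's.

NUMBERS. b₀ = (11 − 2N_f/3)/(16π²) (tree betaCoeff₀); massExponent γ₀/(2β₀) = 12/29, 4/9 (tree
massExponent_three). Step scaling: σ(u) = u + 2b₀ ln2 · u² + O(u³); ALPHA N_f = 3: σ known
non-perturbatively for ḡ² ∈ [1, 7], Λ^(3)_MSbar = 341(12) MeV (arXiv:1607.06423, arXiv:1604.06193).
Femto regime: λ = (g²(L))^(1/3) with periodic b.c. (Luscher1983); tunnelling for z = M(0⁺)L < 1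
(doi:10.1016/0550-3213(86)90252-x §1); twisted SU(3) box: momenta in units 2π/(3L), κ₀ = 2π/3, e = 0
gap 4π/(3L), e₃-splitting ∝ exp(−8π²/(3g²(L))) (doi:10.1016/0370-2693(90)90797-a,
doi:10.1016/0550-3213(94)00126-x, arXiv:hep-ph/0008206 §3.4). Chiral edge: GMOR m_π² ≃ 2B(m_u +
m_d)/F² (rate not claimed); Aoki-phase width / minimal pion mass ∝ a²–a³ in lattice units
(doi:10.1103/physrevd.58.074501), invisible at fixed renormalised m as k → ∞. Box-mixing proxy: ε(ℓ)
≈ 2e^(−3z/8), z = m(ℓ)ℓ. Items: open 6 + 1 informal crux; rev 1: R decls (7 live); rev 2: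
FemtoUniverseGapR typed (7 live); rev 3 (2026-08-16): FiniteVolumeContinuumLimitR → …C,
InfiniteVolumePackageR → …C, + SharpChiralEdge, Assembly restated — 8 live items (6 cruxes, 1
support, 1 assembly).

DEFINITION REQUESTS. (D1) `qcdSlabExpect` (anisotropic periodic torus, time-antiperiodic quarks);
(D2) 't Hooft-twisted and C-periodic boundary conditions for GaugeConfig / wilsonDirac
(KronfeldWiese1991, tHooft1979Flux); (D3) `boxMixing` / `stepScaling` (the inlined box-mixing
profile as a named def, z(ℓ) := −(8/3) log(ε(ℓ)/2), the step relation z(ℓ) ↦ z(2ℓ)) — D1–D3 LANDED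
2026-08-15 (QCDSlab.lean; Twisted/CPeriodicBoundaryConditions.lean; BoxMixingStepScaling.lean); rev
2 filed (D4) `twistedSlabExpect` (twists on spatial AND temporal planes, electric-flux projection)
for the N_f = 3 variant; rev 3 needs none (IsChiralAtZero, HasLatticeMassGap are tree decls). No
cite facts are taken as hypotheses.

Novelty: Searches (2026-08-15): `lit frontier QuantumFields --since 2021` (30 rows: arXiv:2401.10507
Chatterjee YM–Higgs Gaussian limit, arXiv:2606.19362 an unrefereed RP-construction claim,
stochastic-quantisation 2D/3D YM — no finite-volume gap theorem, no step scaling); `lit search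
--source crossref` for Lüscher–Weisz–Wolff / LSWW / Lüscher–Münster / van Baal–Koller /
Martinelli–Olivieri / de Divitiis et al. / Kripfganz–Michael (DOIs below); `lit galaxy search "step
scaling function" --star all` (22 rows: DeGrand–DeTar and Gattringer–Lang textbooks, Les Houches
2009, ALPHA papers, arXiv:2101.04762 — all numerical); `lit galaxy search "femto-universe" --star
all` (6 rows, none mathematical); `lit galaxy search "weak mixing implies strong mixing" --star all`
(Martinelli Saint-Flour LNM 1717, Friedli–Velenik — lattice-scale criteria only); `lit read
doi:10.1016/0550-3213(86)90252-x` pp. 1–2 (Koller–van Baal: "rigorous" = within the zero-momentum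
effective Hamiltonian; z = M(0⁺)L as THE variable; tunnelling for z < 1); negatives index `ledger
negatives --problem QuantumFields`: 0 refuted statements; OpenAlex/S2 rate-limited this session
(logged).
Nearest prior art found: doi:10.1016/0550-3213(91)90298-c (Lüscher–Weisz–Wolff 1991: step scaling
with z = m(L)L, numerical, O(3) model), doi:10.1016/0550-3213(94)90629-7 (LSWW: SU(3) running
coupling by step scaling, numerical), Luscher1983 + doi:10.1016/0550-3213(86)90252-x +
doi:10.1016/0003-4916(87)90032-7 (femto-universe spectrum, periodi  [refs: 10.1016/0550-3213(86, 10.1016/0550-3213(91, 10.1016/0550-3213(94, 10.1016/0003-4916(87, 10.1007/bf02101929, 2401.10507, 2606.19362, 2101.04762, doi:10.1016/0550-3213, doi:10.1016/0003-4916, doi:10.1007/bf02101929, Luscher1983, MagnenRivasseauSeneor1993, DobrushinShlosman1985, JaffeWitten2000]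

Barriers (technique_class: finite-volume-construction, step-scaling, finite-size): - technique_class: finite-volume-construction, step-scaling, finite-size
- Literature.Barriers.QuantumFields.PerturbativeInvisibility: evaded — the infinite-volume rate is Δ
= c/ℓ(m) with ℓ(m) the scale delivered by BoxMixingDecay (an iteration count of the ladder,
non-analytic in g); FemtoGluePilot's c is the tunnelling-split full gap (non-perturbative even in
the femto box); FemtoUniverseGapR's κ₀(1 − O(g²(ℓ)))/ℓ is tree-level visible LEGITIMATELY: finite
volume, twist (no flat directions, isolated twist eaters) AND the e₃ = 0 flux projection with
flux-neutral observables — without the projection the full-transfer-matrix rate is the invisible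
tunnelling splitting exp(−8π²/(3g²)) of the Z₃ flux vacua (the gen-0/gen-2 refutation of
FemtoUniverseGap; barrier-candidate TwistedBoxFluxDegeneracy, not yet catalogued, is evaded exactly
by projection + neutrality).
- Literature.Barriers.QuantumFields.UVStabilityNonUniqueness: met head-on by
FiniteVolumeContinuumLimit, which asks for a-uniform control of renormalised OBSERVABLES (not an
IsUVStabilityConsequence); mitigations: the witness may pass to subsequences (sequential existence
suffices for QCDOf), and the femto child is where convergence is cheapest (every mode weakly
coupled).
- Literature.Barriers.QuantumFields.FixedCouplingUltralocality: respected — every crux runs along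
β_k − afBeta N_f Λ a_k → 0 (asymptotic scaling), never at fixed β.
- Literature.Barriers.QuantumFields.AokiPhaseDichotomy: respected — m_crit(k) is never r

History (route lifecycle, newest last):
- 2026-08-15T18:02:48Z · rev 4: restated Assembly (stmt-QuantumFields-8890) — rev 1 repair step B: Assembly restated over the R decls (the gate does not allow dropping an assembly item); closes already concludes QCD from exactly FiniteVol (planner-rbadge-QuantumFields-FemtoStepScaling-6f027594-0)
- 2026-08-15T18:04:45Z · rev 5: dropped stmt-QuantumFields-8885, stmt-QuantumFields-8886, stmt-QuantumFields-8887, stmt-QuantumFields-8888 — rev 1 repair step C (final): DROP the superseded rev-0 items stmt-8885 PhysicalFiniteSizeCriterion / 8886 BoxMixingDecay / 8887 FiniteVolumeContinuumLimit / 888 (planner-rbadge-QuantumFields-FemtoStepScaling-6f027594-0)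
- 2026-08-15T21:28:37Z · rev 7: restated FemtoUniverseGap (stmt-QuantumFields-9483) — repair (rev 2): FemtoUniverseGap stmt-QuantumFields-9483 refuted-misstated by crux-attacks gen-0/gen-2 (evidence EVIDENCE.md, EVIDENCE-g2.md, FiniteChecks.lean, (planner-rrefute-QuantumFields-FemtoStepScaling-a1d58721-0)
- 2026-08-16T23:26:18Z · rev 9: restated FiniteVolumeContinuumLimitR (stmt-QuantumFields-11450), InfiniteVolumePackageR (stmt-QuantumFields-11451), Assembly (stmt-QuantumFields-11452 proved) — route-repair (statement-revised p117723: `def QCDOf` gained `reg.IsChiralAtZero`), rev 3: RESTATE FiniteVolumeContinuumLimitR → FiniteVolumeContinuumLim (planner-rrepair-QuantumFields-FemtoStepScaling-92cb6e4c-0)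
- 2026-08-23T07:28:54Z · DORMANT — reconciler: no traction for 6 d (last activity item-evidence-added at 2026-08-17T07:27:02Z); parked, not closed — `ledger route dormant route-QuantumFields-Femt (operator:999:3246925)
- 2026-08-28T19:22:54Z · REACTIVATED — reconciler: reactivated — activity statement-closed at 2026-08-28T16:05:46Z after parking at 2026-08-23T07:28:54Z (operator:999:2463759)
- 2026-09-05T00:13:27Z · DORMANT — reconciler: no traction for 5 d (last activity statement-checked at 2026-08-30T23:34:00Z); parked, not closed — `ledger route dormant route-QuantumFields-FemtoS (operator:999:491853)

sub-problem: QCD · status: dormant · opened planner-plancard-QuantumFields-QCD-femto-univ-9414728d-0 2026-08-15T13:39:37Z · rev 9 · ledger route-QuantumFields-FemtoStepScaling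
GENERATED by the gate from the ledger (D-0016/17). Provers cite these decls: `theorem foo : Summit.QuantumFields.QCD.Theses.FemtoStepScaling.<Decl> := …` in Summits/QuantumFields/QCD/Theorems/<Name>.lean.
-/

namespace Summit.QuantumFields.QCD.Theses.FemtoStepScaling

open scoped BigOperators Topology Manifold Classical MeasureTheory ProbabilityTheory Matrix InnerProductSpace ComplexConjugate ContinuousMap
open Filter Set Function TopologicalSpace MeasureTheory

attribute [summit_statement] _root_.QCD

/-- item stmt-QuantumFields-13814 · crux · rank 2 · open · by planner
why it might fail: Weak-coupling RG controls effective ACTIONS, not spectra (UVStabilityNonUniqueness): a T-uniform gap needs Bałaban-type expansions run around three twist-eating backgrounds with the Z₃ flux projection and the thermal e⊥m sectors bounded — nothing such is in print; lattice artefacts only via S₀(ℓ).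
sources: Luscher1983, tHooft1979Flux, arXiv:hep-ph/0008206, doi:10.1016/0370-2693(90)90797-a, doi:10.1016/0550-3213(94)00126-x, arXiv:hep-lat/9302007
[crux] (rev 2: TYPED 1:1 replacement of the informal FemtoUniverseGap stmt-QuantumFields-9483 after
crux-attacks gen-0/gen-2, class refuted-misstated, evidence EVIDENCE.md, FiniteChecks.lean,
EVIDENCE-g2.md, FemtoCruxCertificatesG2.lean. (A) With spatial twist n₁₂ = 1 the three twist-eating
vacua (ω^j·1, P, Q) are permuted by the exact Z₃ centre symmetry along the magnetic flux m =
(0,0,1): the electric-flux sectors e₃ ∈ Z₃ are degenerate to all orders and split only by tunnelling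
∝ exp(−8π²/(3g²(ℓ))) (van Baal hep-ph/0008206 §3.4; RTN hep-lat/9302007 p. 3; Poppitz–Wandler
arXiv:2211.10347 §5.1), and the time-periodic slab ensemble is their equal-weight mixture — so 'ALL
observables, c uniform in T, c = κ₀(1 − O(g²))' failed (Polyakov loop along m). REPAIR = FLUX FRAME:
the ensemble is projected to e₃ = 0 by averaging the twisted Boltzmann weights over the temporal
twist n₀₃ = k ∈ Z₃, and observables must be NEUTRAL for the flux along m; transverse-flux (e ⊥ m,
one-gluon) sectors stay in the thermal trace as genuine excitations of energy ≥ κ₀/ℓ, so κ₀ = 2π/3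
and 'all gauge-invariant observables incl. Polyakov loops along directions 1, 2' survive. (B)
C-periodic variant DROPPED (SU( -/
@[route_item "route-QuantumFields-FemtoStepScaling"]
def FemtoUniverseGapR : Prop :=
  ∀ Λ > 0, ∃ ε₀ > 0, ∃ K : ℝ, ∀ ℓ : ℝ, 0 < ℓ → ℓ * Λ ≤ ε₀ → ∃ C : ℝ, ∃ S₀ : ℕ, ∀ (S T : ℕ) [NeZero S] [NeZero T], S₀ ≤ S → S ≤ T → ∀ Tw : ZMod 3 → Literature.Barriers.QuantumFields.FiniteTemperature.Config 3 T S (Matrix.specialUnitaryGroup (Fin 3) ℂ) → ℝ, Tw = (fun k U => Real.exp (Literature.MathematicalPhysics.QuantumFieldTheory.afBeta 0 Λ (ℓ / (S : ℝ)) * ∑ x : Literature.Barriers.QuantumFields.FiniteTemperature.Site 3 T S, ((if x.2 0 = -1 ∧ x.2 1 = -1 then ((Literature.MathematicalPhysics.QuantumLattice.centerPhase 3 (-1) * ((Literature.MathematicalPhysics.QuantumLattice.fundamentalRep (Fin 3)) (Literature.Barriers.QuantumFields.FiniteTemperature.plaquette U x (some 0) (some 1))).trace).re - ((Literature.MathematicalPhysics.QuantumLattice.fundamentalRep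 (Fin 3)) (Literature.Barriers.QuantumFields.FiniteTemperature.plaquette U x (some 0) (some 1))).trace.re) else 0) + (if x.1 = -1 ∧ x.2 2 = -1 then ((Literature.MathematicalPhysics.QuantumLattice.centerPhase 3 (-k) * ((Literature.MathematicalPhysics.QuantumLattice.fundamentalRep (Fin 3)) (Literature.Barriers.QuantumFields.FiniteTemperature.plaquette U x none (some 2))).trace).re - ((Literature.MathematicalPhysics.QuantumLattice.fundamentalRep (Fin 3)) (Literature.Barriers.QuantumFields.FiniteTemperature.plaquette U x none (some 2))).trace.re) else 0)))) → ∀ Ex : (Literature.Barriers.QuantumFields.FiniteTemperature.Config 3 T S (Matrix.specialUnitaryGroup (Fin 3) ℂ) → ℝ) → ℝ, Ex = (fun F => (∑ k : ZMod 3, Literature.Barriers.QuantumFields.FiniteTemperature.expectation (Literature.MathematicalPhysics.QuantumLattice.fundamentalRep (Fin 3)) (Literature.MathematicalPhysics.QuantumFieldTheory.afBeta 0 Λ (ℓ / (S : ℝ))) (Literature.MathematicalPhysics.QuantumFieldTheory.afBeta 0 Λ (ℓ / (S : ℝ))) (fun U : Literature.Barriers.QuantumFields.FiniteTemperature.Config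 3 T S (Matrix.specialUnitaryGroup (Fin 3) ℂ) => F U * Tw k U)) / (∑ k : ZMod 3, Literature.Barriers.QuantumFields.FiniteTemperature.expectation (Literature.MathematicalPhysics.QuantumLattice.fundamentalRep (Fin 3)) (Literature.MathematicalPhysics.QuantumFieldTheory.afBeta 0 Λ (ℓ / (S : ℝ))) (Literature.MathematicalPhysics.QuantumFieldTheory.afBeta 0 Λ (ℓ / (S : ℝ))) (Tw k))) → ∀ Adm : Literature.MathematicalPhysics.QuantumFieldTheory.YMSpecies (Matrix.specialUnitaryGroup (Fin 3) ℂ) → Prop, Adm = (fun A => (∀ V, |A.F V| ≤ 1) ∧ (∀ e ∈ A.supp, (0 : ℤ) ≤ e.1 0 ∧ 8 * e.1 0 ≤ (S : ℤ)) ∧ (∀ c : Matrix.specialUnitaryGroup (Fin 3) ℂ, (∀ g : Matrix.specialUnitaryGroup (Fin 3) ℂ, c * g = g * c) → ∀ V : Literature.MathematicalPhysics.QuantumLattice.LGConfig 4 (Matrix.specialUnitaryGroup (Fin 3) ℂ), A.F (fun e => if e.2 = 3 ∧ (S : ℤ) ∣ (e.1 3 + 1) then c * V e else V e) = A.F V))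 → ∀ n : ℕ, 2 * n ≤ T → ∀ A B : Literature.MathematicalPhysics.QuantumFieldTheory.YMSpecies (Matrix.specialUnitaryGroup (Fin 3) ℂ), Adm A → Adm B → |Ex (fun U => A.F (Literature.MathematicalPhysics.QuantumFieldTheory.slabLift T S U) * B.F (Literature.MathematicalPhysics.QuantumLattice.configShift (-(Pi.single (0 : Fin 4) ((n : ℕ) : ℤ))) (Literature.MathematicalPhysics.QuantumFieldTheory.slabLift T S U))) - Ex (fun U => A.F (Literature.MathematicalPhysics.QuantumFieldTheory.slabLift T S U)) * Ex (fun U => B.F (Literature.MathematicalPhysics.QuantumLattice.configShift (-(Pi.single (0 : Fin 4) ((n : ℕ) : ℤ))) (Literature.MathematicalPhysics.QuantumFieldTheory.slabLift T S U)))| ≤ C * Real.exp (-((2 * Real.pi / 3) * (1 - K / Real.log (1 / (ℓ * Λ))) * (n : ℝ) / (S : ℝ)))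

/-- item stmt-QuantumFields-11448 · crux · rank 3 · open · by planner
why it might fail: Known finite-size criteria (Dobrushin–Shlosman, Martinelli–Olivieri) are lattice-scale with entropy factors (ℓ/a)³ that diverge as a→0; time-slab mixing = gap of H on the ℓ³ torus, and m(ℓ) ≫ 1/ℓ need not control m(∞) without an RG step inside the closure.
sources: DobrushinShlosman1985, doi:10.1007/bf02101929, doi:10.1007/978-94-011-1691-6_38, Luscher1977, JaffeWitten2000, doi:10.1016/0550-3213(86)90252-x
[crux] (rev 1 of PhysicalFiniteSizeCriterion stmt-QuantumFields-8885, planner route-repair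
2026-08-15 on the refuter's non-blocking remark in route-review rreview-0815T13-5: two side
conditions added as hypotheses — m_crit(k) > −1 eventually and all m_f > 0 — so the closure is not
asserted for bare Wilson masses ≤ −1 / κ ≥ 1/6 or through the Aoki region, where transfer-matrix
positivity (Montvay–Münster (4.111)) and hence 'slab mixing ⇒ gap' have no mechanism; box-mixing
hypothesis and gap conclusion verbatim as checked.) THE CLOSURE (card F4). There are universal ε, c
> 0 such that for N_f ∈ {2,3}, every regularisation `reg` with two-loop asymptotic scaling, every
POSITIVE mass tuple m and every physical scale ℓ > 0, provided m_crit(k) > −1 eventually: if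
eventually in k, on the hypercubic torus of side 2⌊ℓ/2a_k⌋+1 at (β_k, m_f(k)), the (−1)^F-twisted
partition function is non-zero and every pair A, B of gauge-invariant bounded (sup ≤ 1) gluonic
cylinder observables supported in the time-slab [0, ℓ/8] has connected covariance ≤ ε between A and
B translated by half the box, THEN for every pair of gluonic observables the connected
time-correlations on ALL periodic tori of side 2S+1 -/
@[route_item "route-QuantumFields-FemtoStepScaling"]
def PhysicalFiniteSizeCriterionR : Prop :=
  ∃ ε c : ℝ, 0 < ε ∧ 0 < c ∧ ∀ (Nf : ℕ) (reg : Literature.MathematicalPhysics.QuantumFieldTheory.QCDRegularisation Nf) (m : Fin Nf → ℝ) (ℓ : ℝ), 2 ≤ Nf → Nf ≤ 3 → 0 < ℓ → (∃ Λ > 0, Tendsto (fun k => reg.β k - Literature.MathematicalPhysics.QuantumFieldTheory.afBeta Nf Λ (reg.a k)) atTop (nhds 0)) → (∀ᶠ k in atTop, (-1 : ℝ) < reg.mcrit k) → (∀ fl, 0 < m fl) → (∀ᶠ k in atTop, ∀ S : ℕ, S = ⌊ℓ / (2 * reg.a k)⌋₊ → (∫ U, Literature.MathematicalPhysics.QuantumFieldTheory.fermiIntegral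 (Literature.MathematicalPhysics.QuantumFieldTheory.fermiBoltzmann U (fun fl => (reg.scheme m 0 0).mq fl k)) ∂(Literature.MathematicalPhysics.QuantumFieldTheory.wilsonMeasure (d := 4) (L := (2 * S + 1)) (Literature.MathematicalPhysics.QuantumLattice.fundamentalRep (Fin 3)) (reg.β k))) ≠ 0 ∧ ∀ Ex : (Literature.MathematicalPhysics.QuantumFieldTheory.GaugeConfig 4 (2 * S + 1) (Matrix.specialUnitaryGroup (Fin 3) ℂ) → Literature.MathematicalPhysics.QuantumFieldTheory.FermiAlg Nf (2 * S + 1)) → ℂ, Ex = Literature.MathematicalPhysics.QuantumFieldTheory.qcdTorusExpect (reg.β k) (2 * S + 1) (fun fl => (reg.scheme m 0 0).mq fl k) → ∀ ι : ℝ → Literature.MathematicalPhysics.QuantumFieldTheory.FermiAlg Nf (2 * S + 1), ι = (fun r : ℝ => algebraMap ℂ _ (r : ℂ)) → ∀ InSlab : Literature.MathematicalPhysics.QuantumFieldTheory.YMSpecies (Matrix.specialUnitaryGroup (Fin 3) ℂ) → Prop, InSlab = (fun A => (∀ U, |A.F U| ≤ 1) ∧ (∀ e ∈ A.supp, (0 :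 ℤ) ≤ e.1 0 ∧ (8 : ℝ) * ((e.1 0 : ℤ) : ℝ) * reg.a k ≤ ℓ)) → ∀ A B : Literature.MathematicalPhysics.QuantumFieldTheory.YMSpecies (Matrix.specialUnitaryGroup (Fin 3) ℂ), InSlab A → InSlab B → ‖(Ex (fun U => ι (A.F (Literature.MathematicalPhysics.QuantumLattice.torusLift (2 * S + 1) U)) * ι (B.F (Literature.MathematicalPhysics.QuantumLattice.configShift (-(Pi.single (0 : Fin 4) ((S : ℕ) : ℤ))) (Literature.MathematicalPhysics.QuantumLattice.torusLift (2 * S + 1) U)))) - Ex (fun U => ι (A.F (Literature.MathematicalPhysics.QuantumLattice.torusLift (2 * S + 1) U))) * Ex (fun U => ι (B.F (Literature.MathematicalPhysics.QuantumLattice.configShift (-(Pi.single (0 : Fin 4) ((S : ℕ) : ℤ))) (Literature.MathematicalPhysics.QuantumLattice.torusLift (2 * S + 1) U)))))‖ ≤ ε) → (∀ A B : Literature.MathematicalPhysics.QuantumFieldTheory.YMSpecies (Matrix.specialUnitaryGroup (Fin 3) ℂ), ∃ C : ℝ, ∀ᶠ k in atTop, ∀ S : ℕ, reg.L k ≤ S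 → ∀ Ex : (Literature.MathematicalPhysics.QuantumFieldTheory.GaugeConfig 4 (2 * S + 1) (Matrix.specialUnitaryGroup (Fin 3) ℂ) → Literature.MathematicalPhysics.QuantumFieldTheory.FermiAlg Nf (2 * S + 1)) → ℂ, Ex = Literature.MathematicalPhysics.QuantumFieldTheory.qcdTorusExpect (reg.β k) (2 * S + 1) (fun fl => (reg.scheme m 0 0).mq fl k) → ∀ ι : ℝ → Literature.MathematicalPhysics.QuantumFieldTheory.FermiAlg Nf (2 * S + 1), ι = (fun r : ℝ => algebraMap ℂ _ (r : ℂ)) → ∀ n : ℕ, n ≤ S → ‖(Ex (fun U => ι (A.F (Literature.MathematicalPhysics.QuantumLattice.torusLift (2 * S + 1) U)) * ι (B.F (Literature.MathematicalPhysics.QuantumLattice.configShift (-(Pi.single (0 : Fin 4) ((n : ℕ) : ℤ))) (Literature.MathematicalPhysics.QuantumLattice.torusLift (2 * S + 1) U)))) - Ex (fun U => ι (A.F (Literature.MathematicalPhysics.QuantumLattice.torusLift (2 * S + 1) U))) * Ex (fun U => ι (B.F (Literature.MathematicalPhysics.QuantumLattice.configShift (-(Pi.single (0 : Fin 4) ((n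 : ℕ) : ℤ))) (Literature.MathematicalPhysics.QuantumLattice.torusLift (2 * S + 1) U)))))‖ ≤ C * Real.exp (-((c / ℓ) * (reg.a k * n))))

/-- item stmt-QuantumFields-11449 · crux · rank 4 · open · by planner
why it might fail: This IS 'no infrared fixed point and the box eventually exceeds the correlation length' for N_f = 2, 3 — the gap conjecture in finite-size form; σ(u) > u is provable only for small u (asymptotic freedom), no monotone quantity in ℓ is known beyond PT.
sources: doi:10.1016/0550-3213(91)90298-c, doi:10.1016/0550-3213(94)90629-7, arXiv:2101.04762, arXiv:1604.06193, JaffeWitten2000, Luscher2010WilsonFlow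
[crux] (rev 1 of BoxMixingDecay stmt-QuantumFields-8886, planner route-repair 2026-08-15 after
refuter route-review rreview-0815T13-5: the HYPOTHESIS — the inlined convergence clause + N2 of the
UV crux — is now the guarded one of FiniteVolumeContinuumLimitR (convergence asked only for test
functions with pairwise-disjoint closed supports; N2 witnesses time-separated), so it is met by
honest finite-volume QCD data and by nothing under-renormalised, and genuinely feeds the ladder
(FemtoStart / SigmaNoFixedPoint); the CONCLUSION (twisted Z ≠ 0 and box mixing ≤ ε at some physical
scale, eventually in k, above a mass offset) is verbatim as checked.) THE LADDER'S OUTPUT (card F2 ∧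
F3: "σ exists and has no fixed point, so finitely many doublings pass any threshold"). For N_f ∈
{2,3} and every `reg` with leading-log mass scaling, two-loop asymptotic scaling and m_crit(k) > −1
eventually, IF the finite-volume continuum limits of FiniteVolumeContinuumLimitR exist for `reg`
with dynamical quarks (its disjoint-support convergence clause and time-separated N2 only, as
hypothesis — weaker than the full UV clause, so the glue extracts it), THEN there is an offset M₀
such that for all mass tuples -/
@[route_item "route-QuantumFields-FemtoStepScaling"]
def BoxMixingDecayR : Prop :=
  ∀ (Nf : ℕ) (reg : Literature.MathematicalPhysics.QuantumFieldTheory.QCDRegularisation Nf), 2 ≤ Nf → Nf ≤ 3 → (reg.HasMassScaling ∧ (∃ Λ > 0, Tendsto (fun k => reg.β k - Literature.MathematicalPhysics.QuantumFieldTheory.afBeta Nf Λ (reg.a k)) atTop (nhds 0)) ∧ (∀ᶠ k in atTop, (-1 : ℝ) < reg.mcrit k)) → (∀ m : Fin Nf → ℝ, (∀ fl, 0 < m fl) → ∃ z shift : Literature.MathematicalPhysics.QuantumFieldTheory.QCDField Nf → ℕ → ℝ, ∃ W : ((ℓ : ℝ) → (n : ℕ) → (Fin n → Literature.MathematicalPhysics.QuantumFieldTheory.QCDField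 Nf) → (Fin n → SchwartzMap (EuclideanSpace ℝ (Fin 4)) ℝ) → ℂ), ∃ ℓ₀ > 0, (∀ ℓ : ℝ, ℓ₀ ≤ ℓ → ∀ (n : ℕ) (σ : Fin n → Literature.MathematicalPhysics.QuantumFieldTheory.QCDField Nf) (f : Fin n → SchwartzMap (EuclideanSpace ℝ (Fin 4)) ℝ), (∀ i j : Fin n, i ≠ j → Disjoint (tsupport (f i)) (tsupport (f j))) → Tendsto (fun k => Literature.MathematicalPhysics.QuantumFieldTheory.qcdTorusExpect (reg.β k) (2 * ⌊ℓ / (2 * reg.a k)⌋₊ + 1) (fun fl => (reg.scheme m 0 0).mq fl k) (fun U => (List.ofFn fun i : Fin n => (∑ x ∈ Literature.Probability.LatticeModels.box 4 ⌊ℓ / (2 * reg.a k)⌋₊, ((z (σ i) k * reg.a k ^ 4 * (f i) (reg.a k • Literature.MathematicalPhysics.QuantumLattice.siteToE x) : ℝ) : ℂ) • (Literature.MathematicalPhysics.QuantumFieldTheory.insertion U (σ i) x - algebraMap ℂ _ (((shift (σ i) k) : ℝ) : ℂ)))).prod)) atTop (nhds (W ℓ n σ f))) ∧ (∀ fl gl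 : Fin Nf, fl ≠ gl → ∃ ℓ : ℝ, ℓ₀ ≤ ℓ ∧ ∃ f g : SchwartzMap (EuclideanSpace ℝ (Fin 4)) ℝ, tsupport f ⊆ {x | x 0 < 0} ∧ tsupport g ⊆ {x | 0 < x 0} ∧ W ℓ 2 (fun _ => Literature.MathematicalPhysics.QuantumFieldTheory.QCDField.pseudoRe fl gl) ![f, g] ≠ W ℓ 1 (fun _ => Literature.MathematicalPhysics.QuantumFieldTheory.QCDField.pseudoRe fl gl) ![f] * W ℓ 1 (fun _ => Literature.MathematicalPhysics.QuantumFieldTheory.QCDField.pseudoRe fl gl) ![g])) → ∃ M₀ : ℝ, ∀ m : Fin Nf → ℝ, (∀ fl, M₀ < m fl) → ∀ ε > 0, ∃ ℓ > 0, (∀ᶠ k in atTop, ∀ S : ℕ, S = ⌊ℓ / (2 * reg.a k)⌋₊ → (∫ U, Literature.MathematicalPhysics.QuantumFieldTheory.fermiIntegral (Literature.MathematicalPhysics.QuantumFieldTheory.fermiBoltzmann U (fun fl => (reg.scheme m 0 0).mq fl k)) ∂(Literature.MathematicalPhysics.QuantumFieldTheory.wilsonMeasure (d := 4) (L := (2 *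 S + 1)) (Literature.MathematicalPhysics.QuantumLattice.fundamentalRep (Fin 3)) (reg.β k))) ≠ 0 ∧ ∀ Ex : (Literature.MathematicalPhysics.QuantumFieldTheory.GaugeConfig 4 (2 * S + 1) (Matrix.specialUnitaryGroup (Fin 3) ℂ) → Literature.MathematicalPhysics.QuantumFieldTheory.FermiAlg Nf (2 * S + 1)) → ℂ, Ex = Literature.MathematicalPhysics.QuantumFieldTheory.qcdTorusExpect (reg.β k) (2 * S + 1) (fun fl => (reg.scheme m 0 0).mq fl k) → ∀ ι : ℝ → Literature.MathematicalPhysics.QuantumFieldTheory.FermiAlg Nf (2 * S + 1), ι = (fun r : ℝ => algebraMap ℂ _ (r : ℂ)) → ∀ InSlab : Literature.MathematicalPhysics.QuantumFieldTheory.YMSpecies (Matrix.specialUnitaryGroup (Fin 3) ℂ) → Prop, InSlab = (fun A => (∀ U, |A.F U| ≤ 1) ∧ (∀ e ∈ A.supp, (0 : ℤ) ≤ e.1 0 ∧ (8 : ℝ) * ((e.1 0 : ℤ) : ℝ) * reg.a k ≤ ℓ)) → ∀ A B : Literature.MathematicalPhysics.QuantumFieldTheory.YMSpecies (Matrix.specialUnitaryGroup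 (Fin 3) ℂ), InSlab A → InSlab B → ‖(Ex (fun U => ι (A.F (Literature.MathematicalPhysics.QuantumLattice.torusLift (2 * S + 1) U)) * ι (B.F (Literature.MathematicalPhysics.QuantumLattice.configShift (-(Pi.single (0 : Fin 4) ((S : ℕ) : ℤ))) (Literature.MathematicalPhysics.QuantumLattice.torusLift (2 * S + 1) U)))) - Ex (fun U => ι (A.F (Literature.MathematicalPhysics.QuantumLattice.torusLift (2 * S + 1) U))) * Ex (fun U => ι (B.F (Literature.MathematicalPhysics.QuantumLattice.configShift (-(Pi.single (0 : Fin 4) ((S : ℕ) : ℤ))) (Literature.MathematicalPhysics.QuantumLattice.torusLift (2 * S + 1) U)))))‖ ≤ ε)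

/-- item stmt-QuantumFields-17664 · crux · rank 5 · open · by planner
why it might fail: Needs a-uniform control of RENORMALISED composite-field Schwinger functions (tr F² ∝ a⁻⁴, ψ̄γ₅ψ) on every fixed physical torus incl. box-scale strong coupling — beyond Bałaban's stability; AND m_crit pinned at/below κ_c with cutoff-uniform light pions there (lattice Goldstone bound, unproved).
sources: Balaban1987RG1, Balaban1989LargeFieldII, MagnenRivasseauSeneor1993, MontvayMunster1994, arXiv:hep-lat/9207009, arXiv:2401.10507
[crux] (rev 3 of FiniteVolumeContinuumLimitR stmt-QuantumFields-11450, planner route-repair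
2026-08-16 after the statement re-type p117723 — `def QCDOf` gained the conjunct
`reg.IsChiralAtZero`. WHAT CHANGED, and nothing else: the regularisation this item PRODUCES is
additionally chiral at zero, `reg.IsChiralAtZero` (the Statement's clause verbatim: for every ε > 0
some POSITIVE mass tuple has no uniform lattice gap ε). Why here: only the item that CHOOSES
m_crit(k) can pin it; IsChiralAtZero ⟺ m_crit(k) sits at or below the chiral critical line to
o(a_k/Z_m(k)) — a pin strictly below is allowed (the edge Mχ ≥ 0 is then located by SharpChiralEdge
and shifted away in InfiniteVolumePackageC), a pin ABOVE the line would leave renormalised masses in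
(0, M₀] unreachable by every item of the route. Its IR content (a Goldstone-type upper bound on the
lattice pion mass near the critical line, cutoff-uniform) is separable as a lemma `--supports` this
item; the good-trajectory and UV clauses are verbatim rev 1.) 'THE STEP-SCALING FUNCTION EXISTS, ON
A CHIRALLY PINNED REGULARISATION' (card F1(i) ∪ F2). For N_f ∈ {2,3} there is a regularisation `reg`
(a_k → 0, β_k − afBeta N_f Λ a_k → 0, volum -/
@[route_item "route-QuantumFields-FemtoStepScaling"]
def FiniteVolumeContinuumLimitC : Prop :=
  ∀ Nf : ℕ, 2 ≤ Nf → Nf ≤ 3 → ∃ reg : Literature.MathematicalPhysics.QuantumFieldTheory.QCDRegularisation Nf, (reg.HasMassScaling ∧ (∃ Λ > 0, Tendsto (fun k => reg.β k - Literature.MathematicalPhysics.QuantumFieldTheory.afBeta Nf Λ (reg.a k)) atTop (nhds 0)) ∧ (∀ᶠ k in atTop, (-1 : ℝ) < reg.mcrit k)) ∧ reg.IsChiralAtZero ∧ (∀ m : Fin Nf → ℝ, (∀ fl, 0 < m fl) → ∃ z shift : Literature.MathematicalPhysics.QuantumFieldTheory.QCDField Nf → ℕ → ℝ, ∃ W :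 ((ℓ : ℝ) → (n : ℕ) → (Fin n → Literature.MathematicalPhysics.QuantumFieldTheory.QCDField Nf) → (Fin n → SchwartzMap (EuclideanSpace ℝ (Fin 4)) ℝ) → ℂ), ∃ ℓ₀ > 0, (∀ ℓ : ℝ, ℓ₀ ≤ ℓ → ∀ (n : ℕ) (σ : Fin n → Literature.MathematicalPhysics.QuantumFieldTheory.QCDField Nf) (f : Fin n → SchwartzMap (EuclideanSpace ℝ (Fin 4)) ℝ), (∀ i j : Fin n, i ≠ j → Disjoint (tsupport (f i)) (tsupport (f j))) → Tendsto (fun k => Literature.MathematicalPhysics.QuantumFieldTheory.qcdTorusExpect (reg.β k) (2 * ⌊ℓ / (2 * reg.a k)⌋₊ + 1) (fun fl => (reg.scheme m 0 0).mq fl k) (fun U => (List.ofFn fun i : Fin n => (∑ x ∈ Literature.Probability.LatticeModels.box 4 ⌊ℓ / (2 * reg.a k)⌋₊, ((z (σ i) k * reg.a k ^ 4 * (f i) (reg.a k • Literature.MathematicalPhysics.QuantumLattice.siteToE x) : ℝ) : ℂ) • (Literature.MathematicalPhysics.QuantumFieldTheory.insertion U (σ i) x - algebraMap ℂ _ (((shift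 (σ i) k) : ℝ) : ℂ)))).prod)) atTop (nhds (W ℓ n σ f))) ∧ (∀ fl gl : Fin Nf, fl ≠ gl → ∃ ℓ : ℝ, ℓ₀ ≤ ℓ ∧ ∃ f g : SchwartzMap (EuclideanSpace ℝ (Fin 4)) ℝ, tsupport f ⊆ {x | x 0 < 0} ∧ tsupport g ⊆ {x | 0 < x 0} ∧ W ℓ 2 (fun _ => Literature.MathematicalPhysics.QuantumFieldTheory.QCDField.pseudoRe fl gl) ![f, g] ≠ W ℓ 1 (fun _ => Literature.MathematicalPhysics.QuantumFieldTheory.QCDField.pseudoRe fl gl) ![f] * W ℓ 1 (fun _ => Literature.MathematicalPhysics.QuantumFieldTheory.QCDField.pseudoRe fl gl) ![g]) ∧ ∀ s₀ : Literature.MathematicalPhysics.QuantumFieldTheory.QCDField Nf, s₀ = Literature.MathematicalPhysics.QuantumFieldTheory.QCDField.glue → (∃ ℓ : ℝ, ℓ₀ ≤ ℓ ∧ ∃ f g : SchwartzMap (EuclideanSpace ℝ (Fin 4)) ℝ, tsupport f ⊆ {x | x 0 < 0} ∧ tsupport g ⊆ {x | 0 < x 0} ∧ W ℓ 2 (fun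 _ => s₀) ![f, g] ≠ W ℓ 1 (fun _ => s₀) ![f] * W ℓ 1 (fun _ => s₀) ![g]) ∧ (∃ ℓ : ℝ, ℓ₀ ≤ ℓ ∧ ∃ f g h : SchwartzMap (EuclideanSpace ℝ (Fin 4)) ℝ, Disjoint (tsupport f) (tsupport g) ∧ Disjoint (tsupport f) (tsupport h) ∧ Disjoint (tsupport g) (tsupport h) ∧ W ℓ 3 (fun _ => s₀) ![f, g, h] - W ℓ 1 (fun _ => s₀) ![f] * W ℓ 2 (fun _ => s₀) ![g, h] - W ℓ 1 (fun _ => s₀) ![g] * W ℓ 2 (fun _ => s₀) ![f, h] - W ℓ 1 (fun _ => s₀) ![h] * W ℓ 2 (fun _ => s₀) ![f, g] + 2 * (W ℓ 1 (fun _ => s₀) ![f] * W ℓ 1 (fun _ => s₀) ![g] * W ℓ 1 (fun _ => s₀) ![h]) ≠ 0))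

/-- item stmt-QuantumFields-17665 · crux · rank 6 · open · by planner
why it might fail: Gluonic time-slab clustering must yield volume independence, E0' (n! growth), full SO(4) invariance of a subsequential lattice limit and decay of QUARK observables (exceptional configurations of D_W near κ_c under a signed determinant) — none is in print for 4D lattice QCD.
sources: OsterwalderSeiler1978, Seiler1982, Luscher1977, OsterwalderSchrader1975, JaffeWitten2000, MontvayMunster1994
[crux] (rev 3 of InfiniteVolumePackageR stmt-QuantumFields-11451, planner route-repair 2026-08-16,
statement re-type p117723. WHAT CHANGED, and nothing else: the offset hypothesis `∃ M₀, ∀ m > M₀, ∃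
Δ > 0, gluonic gap` becomes `∃ M₀, 0 ≤ M₀ ∧ (∀ m > M₀, ∃ Δ > 0, gluonic gap) ∧ (∀ ε > 0, ∃ m > M₀, ¬
(reg.scheme m 0 0).HasLatticeMassGap ε)` — the offset comes WITH its gapless edge (supplied by
SharpChiralEdge) and is non-negative (so the UV hypothesis, stated for positive tuples, covers every
tuple above it). The intended witness is unchanged — `reg` with m_crit shifted by a_k M₀/Z_m(k) —
and the new conjunct of `QCDOf`, `IsChiralAtZero` of that shifted regularisation, is LITERALLY the
transported edge clause (planner's Sketch.lean `example`: `QCDScheme.mk.injEq` + `ring`; cf. retype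
probe isChiralAtZero_shift_iff), so the item's burden is exactly rev 1's.) THE PACKAGE (card F5).
For N_f ∈ {2,3} and every `reg` with mass scaling, asymptotic scaling, m_crit > −1 eventually and
the non-degenerate finite-volume limits of FiniteVolumeContinuumLimitC (UV clause only; chirality of
`reg` is not assumed): if above some offset M₀ ≥ 0 every mass tuple has SOME Δ > 0 with the gluonic
uniform la -/
@[route_item "route-QuantumFields-FemtoStepScaling"]
def InfiniteVolumePackageC : Prop :=
  open Literature.MathematicalPhysics.QuantumFieldTheory in ∀ (Nf : ℕ) (reg : QCDRegularisation Nf), 2 ≤ Nf → Nf ≤ 3 → (reg.HasMassScaling ∧ (∃ Λ > 0, Tendsto (fun k => reg.β k - afBeta Nf Λ (reg.a k)) atTop (nhds 0)) ∧ (∀ᶠ k in atTop, (-1 : ℝ) < reg.mcrit k)) → (∀ m : Fin Nf → ℝ, (∀ fl, 0 < m fl) → ∃ z shift : QCDField Nf → ℕ → ℝ, ∃ W : ((ℓ : ℝ) → (n : ℕ) → (Fin n → QCDField Nf) → (Fin n → SchwartzMap (EuclideanSpace ℝ (Fin 4)) ℝ) → ℂ), ∃ ℓ₀ > 0, (∀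 ℓ : ℝ, ℓ₀ ≤ ℓ → ∀ (n : ℕ) (σ : Fin n → QCDField Nf) (f : Fin n → SchwartzMap (EuclideanSpace ℝ (Fin 4)) ℝ), (∀ i j : Fin n, i ≠ j → Disjoint (tsupport (f i)) (tsupport (f j))) → Tendsto (fun k => qcdTorusExpect (reg.β k) (2 * ⌊ℓ / (2 * reg.a k)⌋₊ + 1) (fun fl => (reg.scheme m 0 0).mq fl k) (fun U => (List.ofFn fun i : Fin n => (∑ x ∈ Literature.Probability.LatticeModels.box 4 ⌊ℓ / (2 * reg.a k)⌋₊, ((z (σ i) k * reg.a k ^ 4 * (f i) (reg.a k • Literature.MathematicalPhysics.QuantumLattice.siteToE x) : ℝ) : ℂ) • (insertion U (σ i) x - algebraMap ℂ _ (((shift (σ i) k) : ℝ) : ℂ)))).prod)) atTop (nhds (W ℓ n σ f))) ∧ (∀ fl gl : Fin Nf, fl ≠ gl → ∃ ℓ : ℝ, ℓ₀ ≤ ℓ ∧ ∃ f g : SchwartzMap (EuclideanSpace ℝ (Fin 4)) ℝ, tsupport f ⊆ {x | x 0 < 0} ∧ tsupport g ⊆ {x | 0 < x 0} ∧ W ℓ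 2 (fun _ => QCDField.pseudoRe fl gl) ![f, g] ≠ W ℓ 1 (fun _ => QCDField.pseudoRe fl gl) ![f] * W ℓ 1 (fun _ => QCDField.pseudoRe fl gl) ![g]) ∧ ∀ s₀ : QCDField Nf, s₀ = QCDField.glue → (∃ ℓ : ℝ, ℓ₀ ≤ ℓ ∧ ∃ f g : SchwartzMap (EuclideanSpace ℝ (Fin 4)) ℝ, tsupport f ⊆ {x | x 0 < 0} ∧ tsupport g ⊆ {x | 0 < x 0} ∧ W ℓ 2 (fun _ => s₀) ![f, g] ≠ W ℓ 1 (fun _ => s₀) ![f] * W ℓ 1 (fun _ => s₀) ![g]) ∧ (∃ ℓ : ℝ, ℓ₀ ≤ ℓ ∧ ∃ f g h : SchwartzMap (EuclideanSpace ℝ (Fin 4)) ℝ, Disjoint (tsupport f) (tsupport g) ∧ Disjoint (tsupport f) (tsupport h) ∧ Disjoint (tsupport g) (tsupport h) ∧ W ℓ 3 (fun _ => s₀) ![f, g, h] - W ℓ 1 (fun _ => s₀) ![f] * W ℓ 2 (fun _ => s₀) ![g, h] - W ℓ 1 (fun _ => s₀) ![g] * W ℓ 2 (fun _ => s₀) ![f,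 h] - W ℓ 1 (fun _ => s₀) ![h] * W ℓ 2 (fun _ => s₀) ![f, g] + 2 * (W ℓ 1 (fun _ => s₀) ![f] * W ℓ 1 (fun _ => s₀) ![g] * W ℓ 1 (fun _ => s₀) ![h]) ≠ 0)) → (∃ M₀ : ℝ, 0 ≤ M₀ ∧ (∀ m : Fin Nf → ℝ, (∀ fl, M₀ < m fl) → ∃ Δ > 0, (∀ A B : YMSpecies (Matrix.specialUnitaryGroup (Fin 3) ℂ), ∃ C : ℝ, ∀ᶠ k in atTop, ∀ S : ℕ, reg.L k ≤ S → ∀ Ex : (GaugeConfig 4 (2 * S + 1) (Matrix.specialUnitaryGroup (Fin 3) ℂ) → FermiAlg Nf (2 * S + 1)) → ℂ, Ex = qcdTorusExpect (reg.β k) (2 * S + 1) (fun fl => (reg.scheme m 0 0).mq fl k) → ∀ ι : ℝ → FermiAlg Nf (2 * S + 1), ι = (fun r : ℝ => algebraMap ℂ _ (r : ℂ)) → ∀ n : ℕ, n ≤ S → ‖(Ex (fun U => ι (A.F (Literature.MathematicalPhysics.QuantumLattice.torusLift (2 * S + 1) U)) * ι (B.F (Literature.MathematicalPhysics.QuantumLattice.configShift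 (-(Pi.single (0 : Fin 4) ((n : ℕ) : ℤ))) (Literature.MathematicalPhysics.QuantumLattice.torusLift (2 * S + 1) U)))) - Ex (fun U => ι (A.F (Literature.MathematicalPhysics.QuantumLattice.torusLift (2 * S + 1) U))) * Ex (fun U => ι (B.F (Literature.MathematicalPhysics.QuantumLattice.configShift (-(Pi.single (0 : Fin 4) ((n : ℕ) : ℤ))) (Literature.MathematicalPhysics.QuantumLattice.torusLift (2 * S + 1) U)))))‖ ≤ C * Real.exp (-((Δ) * (reg.a k * n))))) ∧ (∀ ε > 0, ∃ m : Fin Nf → ℝ, (∀ fl, M₀ < m fl) ∧ ¬ (reg.scheme m 0 0).HasLatticeMassGap ε)) → _root_.QCDOf Nf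

/-- item stmt-QuantumFields-17667 · crux · rank 7 · open · by planner
why it might fail: The chiral regime of N_f=2,3 lattice QCD: (a) slab mixing → 0 for arbitrarily light massive pions in the (−1)^F ensemble; (b) a Goldstone UPPER bound m_π → 0 at the edge, uniform in a — χSB / anomaly-matching gaplessness is physics, not theorem; Aoki or first-order structure at κ_c.
sources: MontvayMunster1994, doi:10.1103/physrevd.58.074501, doi:10.1103/physrevd.46.5607, doi:10.1016/0370-2693(87)91296-2, doi:10.1007/978-1-4684-7571-5_9, doi:10.1016/0550-3213(84)90230-x
[crux] (NEW at rev 3, planner route-repair 2026-08-16, statement re-type p117723: `QCDOf` gained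
`reg.IsChiralAtZero`, so the additive offset is pinned to the chiral point and the route's `∃ M₀`
device must be discharged AT A GAPLESS EDGE.) THE SHARP CHIRAL EDGE. For N_f ∈ {2,3} and every
regularisation `reg` with leading-log mass scaling, two-loop asymptotic scaling and m_crit(k) > −1
eventually which is CHIRAL AT ZERO (`reg.IsChiralAtZero`): IF box mixing decays above SOME offset M₀
(verbatim the conclusion of BoxMixingDecayR: for every tuple m > M₀ and ε > 0 a physical scale ℓ
with, eventually in k, (−1)^F-twisted partition function ≠ 0 and sup-normalised slab covariance of
all bounded gluonic cylinder observables across half the ℓ-hypercube ≤ ε), THEN there is an edge Mχ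
≥ 0 such that (a) box mixing decays for EVERY tuple with all m_f > Mχ (the ladder climbs past
threshold for arbitrarily light MASSIVE pions — decay reaches down to the edge, no intermediate
non-chiral obstruction), and (b) the edge is gapless from above: for every ε > 0 some tuple with all
m_f > Mχ has `¬ (reg.scheme m 0 0).HasLatticeMassGap ε` (Goldstone: m_π → 0 as m → Mχ⁺,
cutoff-uniformly; the clause at Mχ -/
@[route_item "route-QuantumFields-FemtoStepScaling"]
def SharpChiralEdge : Prop :=
  open Literature.MathematicalPhysics.QuantumFieldTheory in ∀ (Nf : ℕ) (reg : QCDRegularisation Nf), 2 ≤ Nf → Nf ≤ 3 → (reg.HasMassScaling ∧ (∃ Λ > 0, Tendsto (fun k => reg.β k - afBeta Nf Λ (reg.a k)) atTop (nhds 0)) ∧ (∀ᶠ k in atTop, (-1 : ℝ) < reg.mcrit k)) → reg.IsChiralAtZero → (∃ M₀ : ℝ, ∀ m : Fin Nf → ℝ, (∀ fl, M₀ < m fl) → ∀ ε > 0, ∃ ℓ > 0, (∀ᶠ k in atTop, ∀ S : ℕ, S = ⌊ℓ / (2 * reg.a k)⌋₊ → (∫ U, fermiIntegral (fermiBoltzmann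 U (fun fl => (reg.scheme m 0 0).mq fl k)) ∂(wilsonMeasure (d := 4) (L := (2 * S + 1)) (Literature.MathematicalPhysics.QuantumLattice.fundamentalRep (Fin 3)) (reg.β k))) ≠ 0 ∧ ∀ Ex : (GaugeConfig 4 (2 * S + 1) (Matrix.specialUnitaryGroup (Fin 3) ℂ) → FermiAlg Nf (2 * S + 1)) → ℂ, Ex = qcdTorusExpect (reg.β k) (2 * S + 1) (fun fl => (reg.scheme m 0 0).mq fl k) → ∀ ι : ℝ → FermiAlg Nf (2 * S + 1), ι = (fun r : ℝ => algebraMap ℂ _ (r : ℂ)) → ∀ InSlab : YMSpecies (Matrix.specialUnitaryGroup (Fin 3) ℂ) → Prop, InSlab = (fun A => (∀ U, |A.F U| ≤ 1) ∧ (∀ e ∈ A.supp, (0 : ℤ) ≤ e.1 0 ∧ (8 : ℝ) * ((e.1 0 : ℤ) : ℝ) * reg.a k ≤ ℓ)) → ∀ A B : YMSpecies (Matrix.specialUnitaryGroup (Fin 3) ℂ), InSlab A → InSlab B → ‖(Ex (fun U => ι (A.F (Literature.MathematicalPhysics.QuantumLattice.torusLift (2 * S + 1) U)) * ι (B.F (Literature.MathematicalPhysics.QuantumLattice.configShift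 (-(Pi.single (0 : Fin 4) ((S : ℕ) : ℤ))) (Literature.MathematicalPhysics.QuantumLattice.torusLift (2 * S + 1) U)))) - Ex (fun U => ι (A.F (Literature.MathematicalPhysics.QuantumLattice.torusLift (2 * S + 1) U))) * Ex (fun U => ι (B.F (Literature.MathematicalPhysics.QuantumLattice.configShift (-(Pi.single (0 : Fin 4) ((S : ℕ) : ℤ))) (Literature.MathematicalPhysics.QuantumLattice.torusLift (2 * S + 1) U)))))‖ ≤ ε)) → ∃ Mχ : ℝ, 0 ≤ Mχ ∧ (∀ m : Fin Nf → ℝ, (∀ fl, Mχ < m fl) → ∀ ε > 0, ∃ ℓ > 0, (∀ᶠ k in atTop, ∀ S : ℕ, S = ⌊ℓ / (2 * reg.a k)⌋₊ → (∫ U, fermiIntegral (fermiBoltzmann U (fun fl => (reg.scheme m 0 0).mq fl k)) ∂(wilsonMeasure (d := 4) (L := (2 * S + 1)) (Literature.MathematicalPhysics.QuantumLattice.fundamentalRep (Fin 3)) (reg.β k))) ≠ 0 ∧ ∀ Ex : (GaugeConfig 4 (2 * S + 1) (Matrix.specialUnitaryGroup (Fin 3) ℂ) → FermiAlg Nf (2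 * S + 1)) → ℂ, Ex = qcdTorusExpect (reg.β k) (2 * S + 1) (fun fl => (reg.scheme m 0 0).mq fl k) → ∀ ι : ℝ → FermiAlg Nf (2 * S + 1), ι = (fun r : ℝ => algebraMap ℂ _ (r : ℂ)) → ∀ InSlab : YMSpecies (Matrix.specialUnitaryGroup (Fin 3) ℂ) → Prop, InSlab = (fun A => (∀ U, |A.F U| ≤ 1) ∧ (∀ e ∈ A.supp, (0 : ℤ) ≤ e.1 0 ∧ (8 : ℝ) * ((e.1 0 : ℤ) : ℝ) * reg.a k ≤ ℓ)) → ∀ A B : YMSpecies (Matrix.specialUnitaryGroup (Fin 3) ℂ), InSlab A → InSlab B → ‖(Ex (fun U => ι (A.F (Literature.MathematicalPhysics.QuantumLattice.torusLift (2 * S + 1) U)) * ι (B.F (Literature.MathematicalPhysics.QuantumLattice.configShift (-(Pi.single (0 : Fin 4) ((S : ℕ) : ℤ))) (Literature.MathematicalPhysics.QuantumLattice.torusLift (2 * S + 1) U)))) - Ex (fun U => ι (A.F (Literature.MathematicalPhysics.QuantumLattice.torusLift (2 * S + 1) U))) * Ex (fun U => ι (B.F (Literature.MathematicalPhysics.QuantumLattice.configShift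 (-(Pi.single (0 : Fin 4) ((S : ℕ) : ℤ))) (Literature.MathematicalPhysics.QuantumLattice.torusLift (2 * S + 1) U)))))‖ ≤ ε)) ∧ (∀ ε > 0, ∃ m : Fin Nf → ℝ, (∀ fl, Mχ < m fl) ∧ ¬ (reg.scheme m 0 0).HasLatticeMassGap ε)

/-- item stmt-QuantumFields-8889 · support · rank 9 · open · by planner
sources: Luscher1983, doi:10.1016/0550-3213(84)90038-5, doi:10.1016/0550-3213(87)90031-9, doi:10.1016/0550-3213(86)90252-x, doi:10.1016/0003-4916(87)90032-7, BorgsSeiler1983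
[support] N_f = 0 PERIODIC PILOT of the femto-universe theorem, typed today in the anisotropic
vocabulary of Literature.Barriers.QuantumFields.FiniteTemperature (time extent T, spatial side S;
Lüscher's 1983 setting): for every Λ > 0 there is ε₀ > 0 such that for every physical box ℓ ≤ ε₀/Λ
there are c > 0, C and S₀ with: for all S ≥ S₀ (spacing a = ℓ/S, isotropic Wilson coupling J_E = J_M
= afBeta 0 Λ (ℓ/S)), all T ≥ S and all n ≤ T/2, the connected correlation of spatial SU(3)
plaquettes at times 0 and n is ≤ C e^(−c n/S) — a cutoff- and T-uniform gap ≥ c/ℓ of the full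
transfer matrix on the periodic ℓ³ box. With periodic b.c. c is NON-perturbative (flux-sector
splitting by tunnelling through the quantum-induced barrier, van Baal–Koller), which is why the
headline crux wants the twist; same proof technology (Bałaban on a box where every coupling is small
+ zero-mode quantum mechanics). [difficulty: XL] -/
@[route_item "route-QuantumFields-FemtoStepScaling"]
def FemtoGluePilot : Prop :=
  ∀ Λ > 0, ∃ ε₀ > 0, ∀ ℓ : ℝ, 0 < ℓ → ℓ * Λ ≤ ε₀ → ∃ c C : ℝ, 0 < c ∧ ∃ S₀ : ℕ, ∀ (S T : ℕ) [NeZero S] [NeZero T], S₀ ≤ S → S ≤ T → ∀ n : ℕ, 2 * n ≤ T → ∀ i j i2 j2 : Fin 3, |Literature.Barriers.QuantumFields.FiniteTemperature.expectation (Literature.MathematicalPhysics.QuantumLattice.fundamentalRep (Fin 3)) (Literature.MathematicalPhysics.QuantumFieldTheory.afBeta 0 Λ (ℓ / S)) (Literature.MathematicalPhysics.QuantumFieldTheory.afBeta 0 Λ (ℓ / S)) (fun U : Literature.Barriers.QuantumFields.FiniteTemperature.Config 3 T S (Matrix.specialUnitaryGroup (Fin 3) ℂ) => ((Literature.MathematicalPhysics.QuantumLattice.fundamentalRep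 (Fin 3)) (Literature.Barriers.QuantumFields.FiniteTemperature.plaquette U (((0 : ℕ) : ZMod T), (0 : Fin 3 → ZMod S)) (some i) (some j))).trace.re * ((Literature.MathematicalPhysics.QuantumLattice.fundamentalRep (Fin 3)) (Literature.Barriers.QuantumFields.FiniteTemperature.plaquette U (((n : ℕ) : ZMod T), (0 : Fin 3 → ZMod S)) (some i2) (some j2))).trace.re) - Literature.Barriers.QuantumFields.FiniteTemperature.expectation (Literature.MathematicalPhysics.QuantumLattice.fundamentalRep (Fin 3)) (Literature.MathematicalPhysics.QuantumFieldTheory.afBeta 0 Λ (ℓ / S)) (Literature.MathematicalPhysics.QuantumFieldTheory.afBeta 0 Λ (ℓ / S)) (fun U : Literature.Barriers.QuantumFields.FiniteTemperature.Config 3 T S (Matrix.specialUnitaryGroup (Fin 3) ℂ) => ((Literature.MathematicalPhysics.QuantumLattice.fundamentalRep (Fin 3)) (Literature.Barriers.QuantumFields.FiniteTemperature.plaquette U (((0 : ℕ) : ZMod T), (0 : Fin 3 → ZMod S)) (some i) (some j))).trace.re) * Literature.Barriers.QuantumFields.FiniteTemperature.expectation (Literature.MathematicalPhysics.QuantumLattice.fundamentalRep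 (Fin 3)) (Literature.MathematicalPhysics.QuantumFieldTheory.afBeta 0 Λ (ℓ / S)) (Literature.MathematicalPhysics.QuantumFieldTheory.afBeta 0 Λ (ℓ / S)) (fun U : Literature.Barriers.QuantumFields.FiniteTemperature.Config 3 T S (Matrix.specialUnitaryGroup (Fin 3) ℂ) => ((Literature.MathematicalPhysics.QuantumLattice.fundamentalRep (Fin 3)) (Literature.Barriers.QuantumFields.FiniteTemperature.plaquette U (((n : ℕ) : ZMod T), (0 : Fin 3 → ZMod S)) (some i2) (some j2))).trace.re)| ≤ C * Real.exp (-(c * n / S))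

-- earlier Assembly (stmt-QuantumFields-11452, replaced 2026-08-16T23:26:18Z -> stmt-QuantumFields-17666): proved by Summit.QuantumFields.QCD.Theorems.femtoStepScalingAssembly_proof — FiniteVolumeContinuumLimitR → BoxMixingDecayR → PhysicalFiniteSizeCriterionR → InfiniteVolumePackageR → QCD
-- earlier Assembly (stmt-QuantumFields-8890, replaced 2026-08-15T18:02:48Z -> stmt-QuantumFields-11452): retired by None — FiniteVolumeContinuumLimit → BoxMixingDecay → PhysicalFiniteSizeCriterion → InfiniteVolumePackage → QCD
/-- item stmt-QuantumFields-17666 · assembly · rank 1 · closed · proved by Summit.QuantumFields.QCD.Theorems.femtoStepScalingAssembly_proof (prover) · by planner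
sources: JaffeWitten2000, MontvayMunster1994
[assembly] (rev 3: restated over the rev-3 decls; rev-1 form FiniteVolumeContinuumLimitR →
BoxMixingDecayR → PhysicalFiniteSizeCriterionR → InfiniteVolumePackageR → QCD, rev-0 form over the
unsuffixed decls) FiniteVolumeContinuumLimitC → BoxMixingDecayR → SharpChiralEdge →
PhysicalFiniteSizeCriterionR → InfiniteVolumePackageC → QCD; proved by the deciding theorem `closes`
of this file (pure logic: the edge Mχ ≥ 0 of SharpChiralEdge replaces rev 1's max M₀ 0; planner's
Sketch.lean `theorem assembly_holds : Assembly := closes`, farm rc 0). -/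
@[route_item "route-QuantumFields-FemtoStepScaling"]
def Assembly : Prop :=
  FiniteVolumeContinuumLimitC → BoxMixingDecayR → SharpChiralEdge → PhysicalFiniteSizeCriterionR → InfiniteVolumePackageC → QCD

-- `Assembly` holds: proved by `Summit.QuantumFields.QCD.Theorems.femtoStepScalingAssembly_proof` (its module imports this route file, so no `_holds` link can be stated here).

-- records of items no longer active in this route (dropped / restated):
-- earlier FiniteVolumeContinuumLimitR (stmt-QuantumFields-11450, replaced 2026-08-16T23:26:18Z -> stmt-QuantumFields-17664): retired by None — ∀ Nf : ℕ, 2 ≤ Nf → Nf ≤ 3 → ∃ reg : Literature.MathematicalPhysics.QuantumFieldTheory.QCDRegularisation Nf, (reg.HasMassScaling ∧ (∃ Λ > 0, Tendsto (fun k => reg.β k - Literature.MathematicalPhysics.QuantumFieldTheory.afBeta Nf Λ (reg.a k)) atTop (nhds 0)) ∧ 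
-- earlier InfiniteVolumePackageR (stmt-QuantumFields-11451, replaced 2026-08-16T23:26:18Z -> stmt-QuantumFields-17665): retired by None — ∀ (Nf : ℕ) (reg : Literature.MathematicalPhysics.QuantumFieldTheory.QCDRegularisation Nf), 2 ≤ Nf → Nf ≤ 3 → (reg.HasMassScaling ∧ (∃ Λ > 0, Tendsto (fun k => reg.β k - Literature.MathematicalPhysics.QuantumFieldTheory.afBeta Nf Λ (reg.a k)) atTop (nhds 0)) ∧ (∀ᶠ 
-- earlier FemtoUniverseGap (stmt-QuantumFields-9483, replaced 2026-08-15T21:28:37Z -> stmt-QuantumFields-13814): retired by None — [crux] FEMTO-UNIVERSE THEOREM (card femto-universe-step-scaling item F1; rank 2 = most informative: the card's bet that it is provable NOW, and the base rung of the ladder whose typed output is BoxMixingDecay; informal until definition requests D1 `qcdSlabExpect` (lattic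

/-! D-0027 §2.1 — DECIDING THEOREM (planner-authored via `route open/edit --closes-file`; by planner-rrepair-QuantumFields-FemtoStepScaling-92cb6e4c-0 2026-08-16T23:26:18Z):
its hypotheses are this route's items and its conclusion the sub-problem Statement (glue_lint), and it elaborates with this file. -/

@[closes "route-QuantumFields-FemtoStepScaling"] theorem closes (h1 : FiniteVolumeContinuumLimitC) (h2 : BoxMixingDecayR) (h5 : SharpChiralEdge)
    (h3 : PhysicalFiniteSizeCriterionR) (h4 : InfiniteVolumePackageC) : QCD := by
  obtain ⟨ε, c, hε, hc, hcrit⟩ := h3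
  have key : ∀ Nf : ℕ, 2 ≤ Nf → Nf ≤ 3 → QCDOf Nf := by
    intro Nf h2le hle3
    obtain ⟨reg, hgood, hchi, huv⟩ := h1 Nf h2le hle3
    obtain ⟨M₀, hmix⟩ := h2 Nf reg h2le hle3 hgood (fun m hm => by
      obtain ⟨z, shift, W, ℓ₀, hℓ₀, hconv, hN2, -⟩ := huv m hm
      exact ⟨z, shift, W, ℓ₀, hℓ₀, hconv, hN2⟩)
    obtain ⟨Mχ, hMχ, hdec, hedge⟩ := h5 Nf reg h2le hle3 hgood hchi ⟨M₀, hmix⟩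
    refine h4 Nf reg h2le hle3 hgood huv ⟨Mχ, hMχ, fun m hm => ?_, hedge⟩
    have hm0 : ∀ fl, 0 < m fl := fun fl => lt_of_le_of_lt hMχ (hm fl)
    obtain ⟨ℓ, hℓ, hk⟩ := hdec m hm ε hε
    exact ⟨c / ℓ, div_pos hc hℓ, hcrit Nf reg m ℓ h2le hle3 hℓ hgood.2.1 hgood.2.2 hm0 hk⟩
  exact ⟨key 2 le_rfl (by norm_num), key 3 (by norm_num) le_rfl⟩

end Summit.QuantumFields.QCD.Theses.FemtoStepScaling
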